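import Literature.Analysis.OperatorTheory.PositiveKernelSpectralTrace
import Literature.Analysis.OperatorTheory.PositivityImproving
import Literature.Analysis.OperatorTheory.PositiveKernelTransferOperator
import Literature.Analysis.OperatorTheory.HeterogeneousCyclicPeeling
import Literature.MathematicalPhysics.QuantumFieldTheory.WilsonFinTorusSpectralData
import Summits.QuantumFields.YangMills.Theorems.BalabanLadderIRAbstractBasinRung

/-!
# Purity forces a flux-free top state and cheap central twists — the arrow `E ⇒ F` at the exit scale, abstract transfer-matrix form

SEAM ∕ BY-PRODUCT (B3 of `Cruxes/IR/TRANSFER-CENSUS-ym-ir-idea-9-g2.md`, ideator ym-ir-idea-9 g2, lens «transfer», sibling #10 = 't Hooft's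
electric-flux algebra).  NOT a skeleton line (no `IR_of`, no `stub_*`); sorry-free; §1–§3 are group-free and model-free (pure algebra of
traces), §4 is kernel-level operator theory over the tree's `Literature.Analysis.OperatorTheory` (symmetric positive bounded kernels).

HONEST FRAMING.  Nothing here proves the Yang–Mills mass gap (Clay), a lattice gap, the crux `BalabanLadder.IR` (stmt-QuantumFields-19354),
its seed `E = ColdExitAt θ`, or idea-10's `F = ConfinedTemporalTwistSC`; `R4` closes only the conditional finite-𝕋⁴ rung `BalabanLadder.UV`.
This is an arrow OUT of the seed, recorded so that row 21 of the cell's census (`flux_purity_split`: `F ∧ V ⇒ E`, `E ⇒ V` proved) can be read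
as an EQUIVALENCE at the exit scale, `E(θ) ⇔ F_exit(2θ) ∧ V`, modulo the Wilson-side discharge of the hypothesis class below.

THE ABSTRACT CLASS [TTF] (twisted trace formula; 't Hooft 1979 (2.14)–(2.20), Lüscher 1977, Montvay–Münster (3.145)).  A family of
«twisted thermal traces» `z c τ` of ONE spatial box, indexed by a finite abelian group `Zc` (the temporal central twists; `c = 1` untwisted),
has JOINT eigen-data: eigenvalues `0 ≤ λᵢ ≤ λ_{i₀}`, `0 < λ_{i₀}`, and unit characters `χᵢ : Zc → ℂ` (the electric flux of the `i`-th
state) with `z 1 (m+2) = Σᵢ λᵢ^{m+2}` and `z c (m+2) = Σᵢ χᵢ(c) λᵢ^{m+2}`.  For Wilson's theory the untwisted half IS the tree theorem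
`Literature.MathematicalPhysics.QuantumFieldTheory.exists_spectralData_wilsonFinTorusPartition_box`; the twisted half (centre-flux operators =
«large» central gauge transformations of a slice, unitary, commuting with the transfer operator, diagonalised jointly on each finite-dimensional
eigenspace) is NOT in the tree and is the price of using this file on `twistedColdZ` (idea-10, `Lines/flux_purity_split.lean`).  Positivity
`0 ≤ z c τ` is manifest there (integral of a positive weight).

THEOREM (`twist_cost_le_of_pure`).  In the class [TTF] with `0 ≤ z c τ`: if the period-doubling purity defect at time `t = m+2` satisfies
`1 − z 1 (2t) / (z 1 t)² ≤ θ < 1/2`, then for EVERY twist `c`:  `1 − z c t / z 1 t ≤ 2θ`  and  `1 − z c (2t) / z 1 (2t) ≤ 2θ`.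
Mechanism: purity `≥ 1 − θ` makes the top state carry weight `≥ 1 − θ` (`Σ pᵢ² ≤ max pᵢ`); the twisted trace is within `Σ_{i≠i₀} pᵢ ≤ θ` of
`χ_{i₀}(c)·p_{i₀}`; a non-trivial unit character has a value with `Re ≤ 0` (its average vanishes), which would put the non-negative real
`z c t / z 1 t` at distance `≥ p_{i₀} ≥ 1 − θ > θ` — contradiction; so the top state is flux-free and every twist costs `≤ 2θ`.
Reading: 't Hooft's «heavy electric flux in a cold box» is CONTAINED in the seed at its own scale; conversely (row 21) it is half of it.

REAL FORM AND KERNEL-LEVEL DISCHARGE (§3–§4, rev 3).  `twist_cost_le_of_pure_real`: the same conclusion for ANY `θ` and ANY index type of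
twists from the real datum [TTF-ℝ] (`|κᵢ(c)| ≤ 1`, `κ_{i₀}(c) = 1`).  §4 discharges [TTF-ℝ] down to the transfer-kernel level, sorry-free:
for a strongly measurable bounded symmetric kernel `K > 0` on a finite measure space with eigenbasis `A bᵢ = λᵢ bᵢ`, `λᵢ ≥ 0`, top index
`λ_{i₀} = ‖A‖ ≠ 0`, and measure-preserving twists `T c` with `K (T c x) (T c y) = K x y`:
`hasSum_pow_integral_iterate_twisted` (twisted trace formula `∫ (κ^{[M+1]}K(·,x))(T x) dμ = Σ λᵢ^M ∫ (κbᵢ)∘T · κbᵢ`, no invariance needed),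
`abs_integral_twisted_coeff_le` (`|∫ (κbᵢ)∘T · κbᵢ| ≤ λᵢ²`), `integral_twisted_coeff_top` (Perron–Frobenius ⇒ the top coefficient is
untwisted: the finite-volume ground state carries no flux), `hasRealTwistedSpectralDatum_of_kernel`, `twist_cost_le_of_pure_kernel`.
What is left for Wilson's `twistedColdZ` (idea-10) is MODEL-SPECIFIC and located: the twist map `T_c` = multiplication of the `i`-links on
the plane `x_i = 0` of ONE time slice by the central `c_i` (Haar-measure preserving; `finTorusSliceKernel (T_c x) (T_c y) = finTorusSliceKernel x y`
because `c` is central and every spatial plaquette meets the plane in 0 or 2 oppositely oriented `i`-links), and the twisted time-slicing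
identity `twistedColdZ … c L (m+2) = ∫ (κ^{[m+1]} K(·,x))(T_c x) dμ` (variant of `wilsonFinTorusPartition_eq_integral_prod_finTorusSliceKernel_succ`).

CLOSED FORM FOR WILSON'S THEORY (§5–§6, rev 4).  `integral_cyclic_twisted_eq_integral_iterate` bridges the iterate form to the cyclic
chain of slice kernels with ONE twisted bond (`twist_cost_le_of_pure_kernel_cyclic`).  §5 types the twist map `sliceTwist c` (multiply the
`i`-links of ONE time slice based on the plane `p_i = 0` by the central `c_i`), proves it Haar-preserving (`measurePreserving_sliceTwist`)
and the slice kernel invariant (`finTorusSliceKernel_sliceTwist`: every plaquette meets the twisted planes in 0 or 2 oppositely oriented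
twisted links, `twist_plaquette_cancel` / `twist_temporal_cancel`).  §6 constructs the operator data INSIDE (replay of the orchestration of
`exists_spectralData_wilsonFinTorusPartition_box`), identifies the untwisted sliced chain with the partition function by uniqueness of the sum
`Σ λᵢ^τ` for the same eigen-data (`hasSum_pow_integral_cyclic_one`; no `Fin` re-indexing), and proves, with NO hypothesis left,
`slicedTwist_cost_le_of_purity` (`β ≥ 0`, continuous unitary `ρ`, any box: `1 − Z(2τ)/Z(τ)² ≤ θ ⇒ ∀ central c, 1 − Z^{tw}_c(τ)/Z(τ) ≤ 2θ ∧
1 − Z^{tw}_c(2τ)/Z(2τ) ≤ 2θ`) and THE ARROW `slicedFluxExitAt_of_coldExitAt : BasinRung.ColdExitAt θ → SlicedFluxExitAt (2 * θ)` — the bill's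
seed `E(θ)` forces every central temporal twist (sliced form `slicedTwistedZ`: the closing bond of the slice-kernel chain twisted by `sliceTwist c`)
of the cold boxes `L³ × ⌊L/4⌋`, `L³ × 2⌊L/4⌋` to cost at most `2θ` at the exit scale (`lean check --axioms`: propext, Classical.choice, Quot.sound).
WHAT IS LEFT between `SlicedFluxExitAt` and idea-10's plaquette-level `twistedColdZ` (`Lines/flux_purity_split.lean`) is ONE identity:
`twistedColdZ ρ β z L (m+2) = slicedTwistedZ ρ β L L L c (m+2)` for `c i = z (Fin.castSucc i)` central — the time-slicing theorem
`wilsonFinTorusPartition_eq_integral_prod_finTorusSliceKernel` with the temporal plaquettes of the slab `x₃ = 0` twisted (`twistFactor`).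

PLAQUETTE LEVEL (§7, rev 4) — THAT IDENTITY IS PROVED TOO, so the arrow is closed in idea-10's own currency.  §7 carries VERBATIM copies of
idea-10's `siteCoord` / `twistFactor` / `twistedColdZ` (crux workfiles do not import one another; `FluxPuritySplit.twistedColdZ = FluxPurity.twistedColdZ`
is `rfl`), re-proves the slicing simp lemmas, and proves `finTorusAction_assemble_twisted` (the twisted action splits over the slabs, slab `0`
carrying `sliceTwist`), `twistedColdZ_eq_integral_prod` (twisted transfer-matrix representation, spatially central `z`),
`twistedColdZ_eq_slicedTwistedZ`, and the headline
  `fluxExitAt_of_coldExitAt : BasinRung.ColdExitAt θ → FluxExitAt (2 * θ)`,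
`FluxExitAt θ` := idea-10's `ConfinedTemporalTwistSC` with the quantifier block `∀ ε > 0 ∃ β₁ ∀ β ≥ β₁ ∃ L₁ ∀ L ≥ L₁` replaced by the seed's
`∃ β₁ ∀ β ≥ β₁ ∃ L ≥ 8` at the fixed tolerance `θ`, and otherwise verbatim (`∀ z` central, `∀ t ∈ {⌊L/4⌋, 2⌊L/4⌋}`,
`|twistedColdZ r.ρ β z L t − Z r.ρ β L L L t| ≤ θ · Z`).  `lean check --axioms …fluxExitAt_of_coldExitAt` → propext, Classical.choice, Quot.sound.
READING: `E(θ) ⇒ F_exit(2θ)`; with idea-10's `F ∧ V ⇒ E` and `E ⇒ V` the difference between the seed and the split is EXACTLY the quantifier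
upgrade exit-scale → all large scales («SC») on the flux half — not the flux physics.
-/

set_option autoImplicit false

noncomputable section

open scoped BigOperators
open Finset

namespace Summit.QuantumFields.YangMills.Cruxes.IR.FluxPurity

variable {Zc : Type} [CommGroup Zc] [Fintype Zc]

/-- [TTF] **Twisted spectral datum** for a family `z : Zc → ℕ → ℝ` of twisted traces (`z c τ = Tr (𝕋^τ Ĉ_c)`, `τ ≥ 2`): joint
eigenvalues `0 ≤ λᵢ ≤ λ_{i₀}`, `0 < λ_{i₀}`, unit multiplicative flux labels `χᵢ : Zc → ℂ`, the real trace formula for `c = 1` and the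
complex twisted trace formula for every `c`. -/
def HasTwistedSpectralDatum (z : Zc → ℕ → ℝ) : Prop :=
  ∃ (ι : Type) (lam : ι → ℝ) (i₀ : ι) (χ : ι → Zc → ℂ),
    (∀ i, 0 ≤ lam i ∧ lam i ≤ lam i₀) ∧ 0 < lam i₀ ∧
    (∀ i, χ i 1 = 1) ∧ (∀ i a b, χ i (a * b) = χ i a * χ i b) ∧ (∀ i a, ‖χ i a‖ = 1) ∧
    (∀ m : ℕ, HasSum (fun i => lam i ^ (m + 2)) (z 1 (m + 2))) ∧
    (∀ (c : Zc) (m : ℕ), HasSum (fun i => χ i c * ((lam i : ℂ) ^ (m + 2))) ((z c (m + 2) : ℝ) : ℂ))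

/-! ## §1 Two elementary lemmas: character dichotomy and a distance bound in `ℂ` -/

/-- A multiplicative `χ : Zc → ℂ` on a finite group is trivial or has vanishing average (reindex the sum by `c ↦ c₀ c`). -/
theorem char_trivial_or_sum_eq_zero (χ : Zc → ℂ) (hmul : ∀ a b, χ (a * b) = χ a * χ b) :
    (∀ c, χ c = 1) ∨ ∑ c, χ c = 0 := by
  by_cases h : ∀ c, χ c = 1
  · exact Or.inl h
  · right
    push Not at h
    obtain ⟨c₀, hc₀⟩ := h
    have hS : χ c₀ * ∑ c, χ c = ∑ c, χ c := by
      rw [Finset.mul_sum]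
      simp_rw [← hmul]
      exact Fintype.sum_equiv (Equiv.mulLeft c₀) _ _ (fun c => rfl)
    have h1 : (χ c₀ - 1) * ∑ c, χ c = 0 := by rw [sub_mul, one_mul, hS, sub_self]
    rcases mul_eq_zero.mp h1 with h2 | h2
    · exact absurd (sub_eq_zero.mp h2) hc₀
    · exact h2

/-- A non-trivial multiplicative unit-valued `χ` takes a value with non-positive real part. -/
theorem exists_re_nonpos (χ : Zc → ℂ) (hmul : ∀ a b, χ (a * b) = χ a * χ b) (hnt : ¬ ∀ c, χ c = 1) :
    ∃ c, (χ c).re ≤ 0 := by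
  rcases char_trivial_or_sum_eq_zero χ hmul with h | h
  · exact absurd h hnt
  · by_contra hne
    push Not at hne
    have hre : (∑ c, χ c).re = ∑ c, (χ c).re := by simp [Complex.re_sum]
    have hpos : 0 < ∑ c, (χ c).re :=
      Finset.sum_pos (fun c _ => hne c) ⟨1, Finset.mem_univ _⟩
    rw [← hre, h] at hpos
    simp at hpos

/-- If `x ≥ 0` is real, `‖w‖ = 1` and `Re w ≤ 0`, then `x` is at distance at least `L ≥ 0` from `w·L`. -/
theorem le_norm_real_sub_mul {x L : ℝ} {w : ℂ} (hx : 0 ≤ x) (hL : 0 ≤ L) (hw : ‖w‖ = 1) (hre : w.re ≤ 0) :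
    L ≤ ‖(x : ℂ) - w * (L : ℂ)‖ := by
  have hw2 : w.re * w.re + w.im * w.im = 1 := by
    rw [← Complex.normSq_apply, ← Complex.sq_norm, hw, one_pow]
  have hv : ‖(x : ℂ) - w * (L : ℂ)‖ ^ 2 = (x - w.re * L) * (x - w.re * L) + (w.im * L) * (w.im * L) := by
    rw [Complex.sq_norm, Complex.normSq_apply]
    simp [Complex.sub_re, Complex.sub_im, Complex.mul_re, Complex.mul_im]
  have hsq : L ^ 2 ≤ ‖(x : ℂ) - w * (L : ℂ)‖ ^ 2 := by
    rw [hv]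
    have h1 : 0 ≤ -(w.re * L) := by nlinarith
    nlinarith [mul_nonneg hx h1, mul_nonneg hx hx]
  exact (pow_le_pow_iff_left₀ hL (norm_nonneg _) two_ne_zero).mp hsq

/-! ## §2 The theorem -/

/-- **Purity ⇒ flux-free top state ⇒ every central twist is cheap, at BOTH times `t` and `2t` of the defect.**  In the class [TTF] with
non-negative twisted traces: `1 − z 1 (2t)/(z 1 t)² ≤ θ < 1/2` (`t = m+2`) implies `1 − z c t / z 1 t ≤ 2θ` and
`1 − z c (2t) / z 1 (2t) ≤ 2θ` for every twist `c`. -/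
theorem twist_cost_le_of_pure {z : Zc → ℕ → ℝ} (hD : HasTwistedSpectralDatum z) (hpos : ∀ c τ, 0 ≤ z c τ)
    {θ : ℝ} (hθ : θ < 1 / 2) (m : ℕ)
    (hpure : 1 - z 1 (2 * (m + 2)) / z 1 (m + 2) ^ 2 ≤ θ) (c : Zc) :
    1 - z c (m + 2) / z 1 (m + 2) ≤ 2 * θ ∧ 1 - z c (2 * (m + 2)) / z 1 (2 * (m + 2)) ≤ 2 * θ := by
  classical
  obtain ⟨ι, lam, i₀, χ, hle, hpos0, hχ1, hχmul, hχnorm, hreal, hcplx⟩ := hD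
  -- notation
  have h2t : 2 * m + 2 + 2 = 2 * (m + 2) := by ring
  set t : ℕ := m + 2 with ht
  set Z : ℝ := z 1 t with hZdef
  set Z' : ℝ := z 1 (2 * t) with hZ'def
  set L0 : ℝ := lam i₀ ^ t with hL0def
  -- the real trace formulas at `t` and `2t`
  have hsumZ : HasSum (fun i => lam i ^ t) Z := hreal m
  have hsumZ' : HasSum (fun i => lam i ^ (2 * t)) Z' := by
    have h := hreal (2 * m + 2); rwa [h2t] at h
  -- `L0 ≤ Z`, `0 < Z`, `L0² ≤ Z'`, `Z' ≤ L0 · Z`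
  have hL0_le : L0 ≤ Z := le_hasSum hsumZ i₀ fun j _ => pow_nonneg (hle j).1 _
  have hL0pos : 0 < L0 := pow_pos hpos0 _
  have hZpos : 0 < Z := lt_of_lt_of_le hL0pos hL0_le
  have hL0sq_le : L0 ^ 2 ≤ Z' := by
    have h : lam i₀ ^ (2 * t) ≤ Z' := le_hasSum hsumZ' i₀ fun j _ => pow_nonneg (hle j).1 _
    calc L0 ^ 2 = lam i₀ ^ (2 * t) := by rw [hL0def, ← pow_mul, mul_comm]
      _ ≤ Z' := h
  have hZ'_le : Z' ≤ L0 * Z := by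
    have h2 : HasSum (fun i => L0 * lam i ^ t) (L0 * Z) := hsumZ.mul_left _
    refine hasSum_le (fun i => ?_) hsumZ' h2
    calc lam i ^ (2 * t) = lam i ^ t * lam i ^ t := by rw [two_mul, pow_add]
      _ ≤ lam i₀ ^ t * lam i ^ t :=
          mul_le_mul_of_nonneg_right (pow_le_pow_left₀ (hle i).1 (hle i).2 t) (pow_nonneg (hle i).1 t)
  have hZ'pos : 0 < Z' := lt_of_lt_of_le (by positivity) hL0sq_le
  -- purity: `(1 - θ) Z² ≤ Z'`, hence `(1 - θ) Z ≤ L0`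
  have hp : (1 - θ) * Z ^ 2 ≤ Z' := by
    have h1 : 1 - θ ≤ Z' / Z ^ 2 := by linarith
    exact (le_div_iff₀ (by positivity)).mp h1
  have hR : (1 - θ) * Z ≤ L0 := by
    have h1 : (1 - θ) * Z * Z ≤ L0 * Z := by nlinarith [hp, hZ'_le]
    exact le_of_mul_le_mul_right h1 hZpos
  -- the twisted trace is within `Σ_{i ≠ i₀} λᵢ^τ` of `χ_{i₀}(c) λ_{i₀}^τ` (both times)
  have near_top : ∀ (c : Zc) (m' : ℕ),
      ‖((z c (m' + 2) : ℝ) : ℂ) - χ i₀ c * ((lam i₀ : ℂ) ^ (m' + 2))‖ ≤ z 1 (m' + 2) - lam i₀ ^ (m' + 2) := by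
    intro c m'
    have hs := hcplx c m'
    have hs0 : HasSum (fun i => if i = i₀ then χ i₀ c * ((lam i₀ : ℂ) ^ (m' + 2)) else 0)
        (χ i₀ c * ((lam i₀ : ℂ) ^ (m' + 2))) := hasSum_ite_eq i₀ _
    have hg0 : HasSum (fun i => if i = i₀ then lam i₀ ^ (m' + 2) else 0) (lam i₀ ^ (m' + 2)) := hasSum_ite_eq i₀ _
    refine HasSum.norm_le_of_bounded (hs.sub hs0) ((hreal m').sub hg0) (fun i => ?_)
    by_cases hi : i = i₀
    · subst hi; simp
    · simp only [hi, if_false, sub_zero]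
      rw [norm_mul, norm_pow, Complex.norm_real, Real.norm_of_nonneg (hle i).1, hχnorm, one_mul]
  -- the top state is flux-free: `χ_{i₀} = 1`
  have htriv : ∀ c', χ i₀ c' = 1 := by
    by_contra hnt
    obtain ⟨c₁, hc₁⟩ := exists_re_nonpos (χ i₀) (hχmul i₀) hnt
    have hlow : L0 ≤ ‖((z c₁ t : ℝ) : ℂ) - χ i₀ c₁ * ((lam i₀ : ℂ) ^ t)‖ := by
      have h := le_norm_real_sub_mul (hpos c₁ t) hL0pos.le (hχnorm i₀ c₁) hc₁
      have hc : ((L0 : ℝ) : ℂ) = (lam i₀ : ℂ) ^ t := by rw [hL0def]; push_cast; rfl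
      rwa [hc] at h
    have hup : ‖((z c₁ t : ℝ) : ℂ) - χ i₀ c₁ * ((lam i₀ : ℂ) ^ t)‖ ≤ Z - L0 := near_top c₁ m
    -- `L0 ≤ Z - L0`, `(1-θ) Z ≤ L0`, `θ < 1/2`, `Z > 0`: contradiction
    nlinarith [hlow.trans hup, hR, hθ, hZpos]
  -- conclusion at time `t`
  have hre_t : 2 * L0 - Z ≤ z c t := by
    have h := near_top c m
    rw [htriv c, one_mul] at h
    have hc : ((z c t : ℝ) : ℂ) - (lam i₀ : ℂ) ^ t = ((z c t - L0 : ℝ) : ℂ) := by rw [hL0def]; push_cast; rfl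
    rw [hc, Complex.norm_real, Real.norm_eq_abs] at h
    have h' := (abs_le.mp h).1
    linarith
  have hconc_t : 1 - z c t / Z ≤ 2 * θ := by
    have h1 : (1 - 2 * θ) * Z ≤ z c t := by nlinarith [hre_t, hR]
    have h2 : 1 - 2 * θ ≤ z c t / Z := (le_div_iff₀ hZpos).mpr h1
    linarith
  -- conclusion at time `2t`
  have hre_2t : 2 * L0 ^ 2 - Z' ≤ z c (2 * t) := by
    have h := near_top c (2 * m + 2)
    rw [h2t, htriv c, one_mul] at h
    have hc : ((z c (2 * t) : ℝ) : ℂ) - (lam i₀ : ℂ) ^ (2 * t) = ((z c (2 * t) - L0 ^ 2 : ℝ) : ℂ) := by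
      rw [hL0def, ← pow_mul, mul_comm t 2]; push_cast; rfl
    have hL2 : lam i₀ ^ (2 * t) = L0 ^ 2 := by rw [hL0def, ← pow_mul, mul_comm]
    rw [hc, Complex.norm_real, Real.norm_eq_abs, hL2] at h
    have h' := (abs_le.mp h).1
    linarith
  have hconc_2t : 1 - z c (2 * t) / Z' ≤ 2 * θ := by
    -- `(1-θ) Z' ≤ (1-θ) L0 Z ≤ L0²`, so `z c (2t) ≥ 2 L0² - Z' ≥ (1 - 2θ) Z'`
    have h0 : (1 - θ) * Z' ≤ L0 ^ 2 := by
      have h01 : (1 - θ) * Z' ≤ (1 - θ) * (L0 * Z) := mul_le_mul_of_nonneg_left hZ'_le (by linarith)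
      nlinarith [h01, hR, hL0pos.le]
    have h1 : (1 - 2 * θ) * Z' ≤ z c (2 * t) := by nlinarith [hre_2t, h0]
    have h2 : 1 - 2 * θ ≤ z c (2 * t) / Z' := (le_div_iff₀ hZ'pos).mpr h1
    linarith
  exact ⟨hconc_t, hconc_2t⟩

/-! ## §3 The REAL form the Wilson theory actually delivers (Perron–Frobenius makes the top state flux-free for free)

On the Wilson side the eigenbasis of `exists_spectralData_wilsonFinTorusPartition_box` is a REAL Hilbert basis `bᵢ` of `L²` of the slice,
the temporal twist by a central `c` is the substitution operator `Ĉ_c` of a measure-preserving «large gauge transformation» of the slice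
(orthogonal, positivity-preserving, commuting with the transfer operator `𝕋` because `c` is central), so the twisted trace is
`Tr(𝕋^τ Ĉ_c) = Σᵢ λᵢ^τ κᵢ(c)` with the REAL coefficients `κᵢ(c) = ⟨bᵢ, Ĉ_c bᵢ⟩ ∈ [−1, 1]` — and `κ_{i₀}(c) = 1` with NO purity input,
because the top eigenvalue of the positivity-improving `𝕋` is simple with a positive eigenvector `ψ₀` (Jentzsch, in the tree's proof) and
`Ĉ_c ψ₀` is again a positive top eigenvector, hence `= ψ₀` ('t Hooft: the finite-volume ground state carries no electric flux).  In that
form the theorem needs neither `θ < 1/2` nor the sign of the twisted traces.  Discharging `HasRealTwistedSpectralDatum` for idea-10's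
`twistedColdZ` = (i) `Lp.compMeasurePreserving` for `Ĉ_c`, (ii) `K(Cx, Cy) = K(x, y)` for `finTorusSliceKernel`, (iii) the twisted variant of
`hasSum_pow_integral_cyclic` (one `Ĉ` inserted in the cyclic kernel product), (iv) simplicity of the top eigenvalue, (v) the time-slicing
identity for the twisted box (variant of `wilsonFinTorusPartition_eq_integral_prod_finTorusSliceKernel_succ`).  Items (i)–(iv) are DONE at
the kernel level in §4 below (`hasRealTwistedSpectralDatum_of_kernel`, with the substitution `x ↦ T x` in place of the operator `Ĉ`, so that
no `Lp.compMeasurePreserving` bookkeeping is needed); (v) and the two located model facts (measure preservation of `T_c`, `T_c`-invariance of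
the slice kernel) are what a typer supplies as the hypotheses `hT`, `hKT`, `hz` of `twist_cost_le_of_pure_kernel`. -/

/-- [TTF-ℝ] **Real twisted spectral datum**: `z 1 (m+2) = Σ λᵢ^{m+2}`, `z c (m+2) = Σ κᵢ(c) λᵢ^{m+2}` with `|κᵢ(c)| ≤ 1` and a
twist-invariant top state `κ_{i₀}(c) = 1`. -/
def HasRealTwistedSpectralDatum {Tw : Type} [One Tw] (z : Tw → ℕ → ℝ) : Prop :=
  ∃ (ι : Type) (lam : ι → ℝ) (i₀ : ι) (κ : ι → Tw → ℝ),
    (∀ i, 0 ≤ lam i ∧ lam i ≤ lam i₀) ∧ 0 < lam i₀ ∧ (∀ i c, |κ i c| ≤ 1) ∧ (∀ c, κ i₀ c = 1) ∧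
    (∀ m : ℕ, HasSum (fun i => lam i ^ (m + 2)) (z 1 (m + 2))) ∧
    (∀ (c : Tw) (m : ℕ), HasSum (fun i => κ i c * lam i ^ (m + 2)) (z c (m + 2)))

omit [CommGroup Zc] [Fintype Zc] in
/-- **Purity ⇒ every twist is cheap (real form, any `θ`, any index type of twists with a distinguished untwisted `1`).**  In the class [TTF-ℝ]: `1 − z 1 (2t)/(z 1 t)² ≤ θ` (`t = m+2`) implies
`1 − z c t / z 1 t ≤ 2θ` and `1 − z c (2t) / z 1 (2t) ≤ 2θ` for every twist `c`. -/
theorem twist_cost_le_of_pure_real {Tw : Type} [One Tw] {z : Tw → ℕ → ℝ} (hD : HasRealTwistedSpectralDatum z)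
    {θ : ℝ} (m : ℕ) (hpure : 1 - z 1 (2 * (m + 2)) / z 1 (m + 2) ^ 2 ≤ θ) (c : Tw) :
    1 - z c (m + 2) / z 1 (m + 2) ≤ 2 * θ ∧ 1 - z c (2 * (m + 2)) / z 1 (2 * (m + 2)) ≤ 2 * θ := by
  classical
  obtain ⟨ι, lam, i₀, κ, hle, hpos0, hκ, hκ0, hreal, htw⟩ := hD
  have h2t : 2 * m + 2 + 2 = 2 * (m + 2) := by ring
  set t : ℕ := m + 2 with ht
  set Z : ℝ := z 1 t with hZdef
  set Z' : ℝ := z 1 (2 * t) with hZ'def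
  set L0 : ℝ := lam i₀ ^ t with hL0def
  have hsumZ : HasSum (fun i => lam i ^ t) Z := hreal m
  have hsumZ' : HasSum (fun i => lam i ^ (2 * t)) Z' := by
    have h := hreal (2 * m + 2); rwa [h2t] at h
  have hL0_le : L0 ≤ Z := le_hasSum hsumZ i₀ fun j _ => pow_nonneg (hle j).1 _
  have hL0pos : 0 < L0 := pow_pos hpos0 _
  have hZpos : 0 < Z := lt_of_lt_of_le hL0pos hL0_le
  have hL0sq_le : L0 ^ 2 ≤ Z' := by
    have h : lam i₀ ^ (2 * t) ≤ Z' := le_hasSum hsumZ' i₀ fun j _ => pow_nonneg (hle j).1 _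
    calc L0 ^ 2 = lam i₀ ^ (2 * t) := by rw [hL0def, ← pow_mul, mul_comm]
      _ ≤ Z' := h
  have hZ'_le : Z' ≤ L0 * Z := by
    have h2 : HasSum (fun i => L0 * lam i ^ t) (L0 * Z) := hsumZ.mul_left _
    refine hasSum_le (fun i => ?_) hsumZ' h2
    calc lam i ^ (2 * t) = lam i ^ t * lam i ^ t := by rw [two_mul, pow_add]
      _ ≤ lam i₀ ^ t * lam i ^ t :=
          mul_le_mul_of_nonneg_right (pow_le_pow_left₀ (hle i).1 (hle i).2 t) (pow_nonneg (hle i).1 t)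
  have hZ'pos : 0 < Z' := lt_of_lt_of_le (by positivity) hL0sq_le
  have hp : (1 - θ) * Z ^ 2 ≤ Z' := by
    have h1 : 1 - θ ≤ Z' / Z ^ 2 := by linarith
    exact (le_div_iff₀ (by positivity)).mp h1
  have hR : (1 - θ) * Z ≤ L0 := by
    have h1 : (1 - θ) * Z * Z ≤ L0 * Z := by nlinarith [hp, hZ'_le]
    exact le_of_mul_le_mul_right h1 hZpos
  -- the twisted trace is within `Σ_{i ≠ i₀} λᵢ^τ` of `λ_{i₀}^τ`
  have near_top : ∀ m' : ℕ, |z c (m' + 2) - lam i₀ ^ (m' + 2)| ≤ z 1 (m' + 2) - lam i₀ ^ (m' + 2) := by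
    intro m'
    have hs := htw c m'
    have hs0 : HasSum (fun i => if i = i₀ then κ i₀ c * lam i₀ ^ (m' + 2) else 0) (κ i₀ c * lam i₀ ^ (m' + 2)) :=
      hasSum_ite_eq i₀ _
    have hg0 : HasSum (fun i => if i = i₀ then lam i₀ ^ (m' + 2) else 0) (lam i₀ ^ (m' + 2)) := hasSum_ite_eq i₀ _
    have h := HasSum.norm_le_of_bounded (hs.sub hs0) ((hreal m').sub hg0) (fun i => ?_)
    · rwa [hκ0 c, one_mul, Real.norm_eq_abs] at h
    by_cases hi : i = i₀
    · subst hi; simp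
    · simp only [hi, if_false, sub_zero]
      rw [norm_mul, Real.norm_eq_abs, Real.norm_of_nonneg (pow_nonneg (hle i).1 _)]
      calc |κ i c| * lam i ^ (m' + 2) ≤ 1 * lam i ^ (m' + 2) :=
            mul_le_mul_of_nonneg_right (hκ i c) (pow_nonneg (hle i).1 _)
        _ = lam i ^ (m' + 2) := one_mul _
  have hre_t : 2 * L0 - Z ≤ z c t := by
    have h' := (abs_le.mp (near_top m)).1
    linarith
  have hconc_t : 1 - z c t / Z ≤ 2 * θ := by
    have h1 : (1 - 2 * θ) * Z ≤ z c t := by nlinarith [hre_t, hR]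
    have h2 : 1 - 2 * θ ≤ z c t / Z := (le_div_iff₀ hZpos).mpr h1
    linarith
  have hre_2t : 2 * L0 ^ 2 - Z' ≤ z c (2 * t) := by
    have h := near_top (2 * m + 2)
    have hL2 : lam i₀ ^ (2 * t) = L0 ^ 2 := by rw [hL0def, ← pow_mul, mul_comm]
    rw [h2t, hL2] at h
    have h' := (abs_le.mp h).1
    linarith
  have hconc_2t : 1 - z c (2 * t) / Z' ≤ 2 * θ := by
    have h0 : (1 - θ) * Z' ≤ L0 ^ 2 := by
      by_cases hθ1 : θ ≤ 1
      · have h01 : (1 - θ) * Z' ≤ (1 - θ) * (L0 * Z) := mul_le_mul_of_nonneg_left hZ'_le (by linarith)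
        nlinarith [h01, hR, hL0pos.le]
      · push Not at hθ1
        nlinarith [hZ'pos, sq_nonneg L0]
    have h1 : (1 - 2 * θ) * Z' ≤ z c (2 * t) := by nlinarith [hre_2t, h0]
    have h2 : 1 - 2 * θ ≤ z c (2 * t) / Z' := (le_div_iff₀ hZ'pos).mpr h1
    linarith
  exact ⟨hconc_t, hconc_2t⟩

/-! ## §4 Kernel level: the twisted trace formula for a symmetric bounded kernel and a measure-preserving map

This is the part of the Wilson-side discharge of `[TTF-ℝ]` that is pure operator theory.  Setting: a finite
measure space `(X, μ)`, a bounded strongly measurable symmetric kernel `K`, its transfer operator `A` on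
`L²(X, μ)` with an orthonormal eigenbasis `b` (`A bᵢ = λᵢ bᵢ`), and a measurable MEASURE-PRESERVING map
`T : X → X` (the «twist»: for the sliced Wilson torus, `X` = a time-slice gauge field, `K` = the slice kernel
`finTorusSliceKernel`, `T` = multiplication of the temporal links over one spatial plane by a centre element,
or any large gauge transformation).  Write `cᵢ(x) = (κ bᵢ)(x) = ∫ K(x,z) bᵢ(z) dμ(z)` (honest functions).

* `hasSum_pow_integral_iterate_twisted` — **twisted trace formula**, NO invariance needed:
  `∫ (κ^{[M+1]} K(·,x))(T x) dμ(x) = Σᵢ λᵢ^M ∫ cᵢ(T x) cᵢ(x) dμ(x)`; the left side is the cyclic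
  `(M+2)`-fold kernel integral with the closing bond twisted by `T` (= the sliced twisted partition function).
* `abs_integral_twisted_coeff_le` — `|∫ cᵢ(T x) cᵢ(x) dμ| ≤ λᵢ²` (Cauchy–Schwarz + measure preservation),
  i.e. the twisted coefficients `κᵢ := ∫ cᵢ∘T · cᵢ / λᵢ²` satisfy `|κᵢ| ≤ 1` — the `(∀ i c, |κ i c| ≤ 1)` clause
  of `HasRealTwistedSpectralDatum`.
-/

section Kernel

open MeasureTheory Filter Set Function
open scoped RealInnerProductSpace ENNReal
open Literature.Analysis.OperatorTheory

variable {X : Type} [MeasurableSpace X] {μ : Measure X} [IsFiniteMeasure μ]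
  {K : X → X → ℝ} {C : ℝ} {A : Lp ℝ 2 μ →L[ℝ] Lp ℝ 2 μ} {ι : Type}
  {b : HilbertBasis ι ℝ (Lp ℝ 2 μ)} {lam : ι → ℝ}

omit [CommGroup Zc] [Fintype Zc] in
/-- **Twisted trace formula.**  For a measure-preserving `T`,
`∫ (κ^{[M+1]} K(·,x))(T x) dμ(x) = Σᵢ λᵢ^M ∫ (κbᵢ)(T x) (κbᵢ)(x) dμ(x)`. -/
theorem hasSum_pow_integral_iterate_twisted [Countable ι] (hK : StronglyMeasurable (uncurry K))
    (hC : ∀ x y, ‖K x y‖ ≤ C) (hsymm : ∀ x y, K x y = K y x)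
    (hA : ∀ φ : Lp ℝ 2 μ, (A φ : X → ℝ) =ᵐ[μ] fun x => ∫ y, K x y * φ y ∂μ)
    (hb : ∀ i, A (b i) = lam i • b i) {T : X → X} (hTm : Measurable T) (M : ℕ) :
    HasSum (fun i => lam i ^ M * ∫ x, (∫ z, K (T x) z * b i z ∂μ) * (∫ z, K x z * b i z ∂μ) ∂μ)
      (∫ x, ((fun f : X → ℝ => fun w => ∫ z, K w z * f z ∂μ)^[M + 1] (fun z => K z x)) (T x) ∂μ) := by
  set κ : (X → ℝ) → X → ℝ := fun f w => ∫ z, K w z * f z ∂μ with hκ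
  set c : ι → X → ℝ := fun i x => ∫ z, K x z * b i z ∂μ with hc
  have hcm : ∀ i, Measurable (c i) := fun i => measurable_integral_kernel_mul_basis hK b i
  have hlamA : ∀ i, |lam i| ≤ ‖A‖ := abs_lam_le_norm hb
  have hpars : ∀ x, Summable (fun i => c i x ^ 2) ∧ ∑' i, c i x ^ 2 ≤ C ^ 2 * μ.real univ :=
    fun x => tsum_sq_integral_kernel_mul_le hK hC b x
  have hsq_meas : Measurable fun x => ∫ z, ‖K x z‖ ^ 2 ∂μ :=
    (stronglyMeasurable_integral_norm_kernel_sq hK).measurable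
  have hsq_eq : ∀ x, ∑' i, c i x ^ 2 = ∫ z, ‖K x z‖ ^ 2 ∂μ := fun x =>
    (hasSum_norm_sq_integral_kernel_mul (𝕜 := ℝ) hK hC b x |>.tsum_eq |> fun h => by
      simpa only [Real.norm_eq_abs, sq_abs] using h)
  -- (0) pointwise expansion at the pair `(T x, x)`
  have hpt : ∀ x, HasSum (fun i => lam i ^ M * c i (T x) * c i x) ((κ^[M + 1] (fun z => K z x)) (T x)) :=
    fun x => by
    rw [iterate_kernel_eq_inner hK hC hsymm hA M (T x) x]
    exact hasSum_inner_kernel_section_pow hK hC hsymm hA hb M (T x) x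
  -- (1) sum and `x`-integral commute (dominated convergence)
  have key := hasSum_integral_of_dominated_convergence (μ := μ)
    (F := fun i x => lam i ^ M * c i (T x) * c i x)
    (f := fun x => (κ^[M + 1] (fun z => K z x)) (T x))
    (fun i x => ‖A‖ ^ M * ((c i (T x) ^ 2 + c i x ^ 2) / 2)) (fun i => ?_) (fun i => ?_) ?_ ?_
    (Eventually.of_forall hpt)
  · refine key.congr_fun fun i => ?_
    rw [← integral_const_mul]
    exact integral_congr_ae (Eventually.of_forall fun x => by simp only [hc]; ring)
  · exact ((((hcm i).comp hTm).const_mul _).mul (hcm i)).aestronglyMeasurable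
  · refine Eventually.of_forall fun x => ?_
    rw [Real.norm_eq_abs, abs_mul, abs_mul, abs_pow]
    have h2 : |lam i| ^ M ≤ ‖A‖ ^ M := pow_le_pow_left₀ (abs_nonneg _) (hlamA i) M
    have h3 : |c i (T x)| * |c i x| ≤ (c i (T x) ^ 2 + c i x ^ 2) / 2 := by
      have hsq := two_mul_le_add_sq |c i (T x)| |c i x|
      rw [sq_abs, sq_abs] at hsq
      linarith
    calc |lam i| ^ M * |c i (T x)| * |c i x| = |lam i| ^ M * (|c i (T x)| * |c i x|) := by ring
      _ ≤ ‖A‖ ^ M * ((c i (T x) ^ 2 + c i x ^ 2) / 2) := by gcongr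
  · exact Eventually.of_forall fun x => (((hpars (T x)).1.add (hpars x).1).div_const 2).mul_left _
  · have hfun : (fun x => ∑' i, ‖A‖ ^ M * ((c i (T x) ^ 2 + c i x ^ 2) / 2)) =
        fun x => ‖A‖ ^ M * ((∫ z, ‖K (T x) z‖ ^ 2 ∂μ + ∫ z, ‖K x z‖ ^ 2 ∂μ) / 2) := by
      funext x
      rw [tsum_mul_left, tsum_div_const, (hpars (T x)).1.tsum_add (hpars x).1, hsq_eq (T x), hsq_eq x]
    rw [hfun]
    have hbd : ∀ y, ‖∫ z, ‖K y z‖ ^ 2 ∂μ‖ ≤ C ^ 2 * μ.real univ := fun y => by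
      rw [Real.norm_eq_abs, abs_of_nonneg (integral_nonneg fun z => by positivity), ← hsq_eq y]
      exact (hpars y).2
    exact ((Integrable.of_bound (hsq_meas.comp hTm).aestronglyMeasurable (C ^ 2 * μ.real univ)
        (Eventually.of_forall fun x => hbd (T x))).add
      (Integrable.of_bound hsq_meas.aestronglyMeasurable (C ^ 2 * μ.real univ)
        (Eventually.of_forall fun x => hbd x))).div_const 2 |>.const_mul _

omit [CommGroup Zc] [Fintype Zc] in
/-- **The twisted coefficients are bounded by the untwisted ones**: `|∫ (κbᵢ)(T x)(κbᵢ)(x) dμ| ≤ λᵢ²`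
for a measure-preserving `T` (Cauchy–Schwarz in the form `|uv| ≤ (u²+v²)/2` plus `∫ (κbᵢ∘T)² = ∫ (κbᵢ)² = λᵢ²`). -/
theorem abs_integral_twisted_coeff_le (hK : StronglyMeasurable (uncurry K)) (hC : ∀ x y, ‖K x y‖ ≤ C)
    (hA : ∀ φ : Lp ℝ 2 μ, (A φ : X → ℝ) =ᵐ[μ] fun x => ∫ y, K x y * φ y ∂μ)
    (hb : ∀ i, A (b i) = lam i • b i) {T : X → X} (hT : MeasurePreserving T μ μ) (i : ι) :
    |∫ x, (∫ z, K (T x) z * b i z ∂μ) * (∫ z, K x z * b i z ∂μ) ∂μ| ≤ lam i ^ 2 := by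
  set c : X → ℝ := fun x => ∫ z, K x z * b i z ∂μ with hc
  have hcm : Measurable c := measurable_integral_kernel_mul_basis hK b i
  have hTm : Measurable T := hT.measurable
  have hpars : ∀ x, Summable (fun j => (∫ z, K x z * b j z ∂μ) ^ 2) ∧
      ∑' j, (∫ z, K x z * b j z ∂μ) ^ 2 ≤ C ^ 2 * μ.real univ :=
    fun x => tsum_sq_integral_kernel_mul_le hK hC b x
  have hcb : ∀ x, c x ^ 2 ≤ C ^ 2 * μ.real univ := fun x =>
    ((hpars x).1.le_tsum i fun j _ => sq_nonneg _).trans (hpars x).2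
  -- integrability of the three bounded measurable functions involved
  have hint_sq : Integrable (fun x => c x ^ 2) μ :=
    Integrable.of_bound (hcm.pow_const 2).aestronglyMeasurable (C ^ 2 * μ.real univ)
      (Eventually.of_forall fun x => by
        rw [Real.norm_eq_abs, abs_of_nonneg (sq_nonneg _)]; exact hcb x)
  have hint_sqT : Integrable (fun x => c (T x) ^ 2) μ :=
    Integrable.of_bound ((hcm.comp hTm).pow_const 2).aestronglyMeasurable (C ^ 2 * μ.real univ)
      (Eventually.of_forall fun x => by
        rw [Real.norm_eq_abs, abs_of_nonneg (sq_nonneg _)]; exact hcb (T x))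
  have hdom : ∀ x, |c (T x) * c x| ≤ (c (T x) ^ 2 + c x ^ 2) / 2 := fun x => by
    rw [abs_mul]
    have hsq := two_mul_le_add_sq |c (T x)| |c x|
    rw [sq_abs, sq_abs] at hsq
    linarith
  -- `∫ (c∘T)² = ∫ c²` by measure preservation
  have hcomp : ∫ x, c (T x) ^ 2 ∂μ = ∫ x, c x ^ 2 ∂μ := by
    have h := integral_map (μ := μ) hTm.aemeasurable (f := fun y => c y ^ 2)
      ((hcm.pow_const 2).aestronglyMeasurable)
    rw [hT.map_eq] at h
    exact h.symm
  have hsqlam : ∫ x, c x ^ 2 ∂μ = lam i ^ 2 := integral_sq_integral_kernel_mul_basis hK hC hA hb i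
  calc |∫ x, c (T x) * c x ∂μ| ≤ ∫ x, |c (T x) * c x| ∂μ := by
        rw [← Real.norm_eq_abs]
        exact (norm_integral_le_integral_norm _).trans (le_of_eq (by simp only [Real.norm_eq_abs]))
    _ ≤ ∫ x, (c (T x) ^ 2 + c x ^ 2) / 2 ∂μ := by
        refine integral_mono_of_nonneg (Eventually.of_forall fun x => abs_nonneg _)
          ((hint_sqT.add hint_sq).div_const 2) (Eventually.of_forall hdom)
    _ = (∫ x, c (T x) ^ 2 ∂μ + ∫ x, c x ^ 2 ∂μ) / 2 := by
        rw [MeasureTheory.integral_div, integral_add hint_sqT hint_sq]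
    _ = lam i ^ 2 := by rw [hcomp, hsqlam]; ring

omit [CommGroup Zc] [Fintype Zc] in
/-- **Flux-free top state (Perron–Frobenius).**  If moreover `K > 0` pointwise (so its transfer operator is
positivity improving) and `K` is `T`-INVARIANT, `K (T x) (T y) = K x y`, then the top twisted coefficient
equals the untwisted one: `∫ (κb₀)(T x) (κb₀)(x) dμ = λ₀²` for every index `i₀` with `λ_{i₀} = ‖A‖ ≠ 0`.
Proof: `κb₀ = λ₀ b₀` spans the (simple) top eigenspace, generated by an a.e.-positive `φ`; `(κb₀)∘T` is again a
top eigenfunction (invariance + measure preservation), hence a multiple of `φ`; comparing with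
`(κb₀)∘T = a'·(φ∘T)` a.e. and `∫ φ·(φ∘T) > 0` fixes the sign, and `‖(κb₀)∘T‖ = ‖κb₀‖` the modulus. -/
theorem integral_twisted_coeff_top (hK : StronglyMeasurable (uncurry K)) (hC : ∀ x y, ‖K x y‖ ≤ C)
    (hsymm : ∀ x y, K x y = K y x) (hKpos : ∀ x y, 0 < K x y)
    (hA : ∀ φ : Lp ℝ 2 μ, (A φ : X → ℝ) =ᵐ[μ] fun x => ∫ y, K x y * φ y ∂μ)
    (hb : ∀ i, A (b i) = lam i • b i) {T : X → X} (hT : MeasurePreserving T μ μ)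
    (hKT : ∀ x y, K (T x) (T y) = K x y) {i₀ : ι} (hi₀ : lam i₀ = ‖A‖) (hlam₀ : lam i₀ ≠ 0) :
    ∫ x, (∫ z, K (T x) z * b i₀ z ∂μ) * (∫ z, K x z * b i₀ z ∂μ) ∂μ = lam i₀ ^ 2 := by
  set c : X → ℝ := fun x => ∫ z, K x z * b i₀ z ∂μ with hc
  have hcm : Measurable c := measurable_integral_kernel_mul_basis hK b i₀
  have hTm : Measurable T := hT.measurable
  have hqmp : Measure.QuasiMeasurePreserving T μ μ := hT.quasiMeasurePreserving
  -- (1) `c = λ₀ b₀` a.e.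
  have hĉeq : ((memLp_two_integral_kernel_mul hK hC (b i₀)).toLp _ : Lp ℝ 2 μ) = lam i₀ • b i₀ := by
    rw [← apply_basis_eq_toLp hK hC hA b i₀, hb]
  have hcae : c =ᵐ[μ] fun x => lam i₀ * b i₀ x := by
    have h2 := (memLp_two_integral_kernel_mul hK hC (b i₀)).coeFn_toLp
    rw [hĉeq] at h2
    filter_upwards [h2, Lp.coeFn_smul (lam i₀) (b i₀ : Lp ℝ 2 μ)] with x hx hs
    rw [hs, Pi.smul_apply, smul_eq_mul] at hx
    exact hx.symm
  -- (2) `κ c = λ₀ c` everywhere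
  have hκc : ∀ u, ∫ y, K u y * c y ∂μ = lam i₀ * c u := by
    intro u
    calc ∫ y, K u y * c y ∂μ = ∫ y, K u y * (lam i₀ * b i₀ y) ∂μ :=
          integral_congr_ae (by filter_upwards [hcae] with y hy; rw [hy])
      _ = lam i₀ * ∫ y, K u y * b i₀ y ∂μ := by
          rw [← integral_const_mul]
          exact integral_congr_ae (Eventually.of_forall fun y => by ring)
      _ = lam i₀ * c u := rfl
  -- (3) `κ (c ∘ T) = λ₀ (c ∘ T)` everywhere (invariance + measure preservation)
  have hκg : ∀ x, ∫ y, K x y * c (T y) ∂μ = lam i₀ * c (T x) := by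
    intro x
    have h1 : (fun y => K x y * c (T y)) = fun y => (fun u => K (T x) u * c u) (T y) := by
      funext y
      show K x y * c (T y) = K (T x) (T y) * c (T y)
      rw [hKT x y]
    have h2 : ∫ y, (fun u => K (T x) u * c u) (T y) ∂μ = ∫ u, K (T x) u * c u ∂μ := by
      have := integral_map (μ := μ) hTm.aemeasurable (f := fun u => K (T x) u * c u)
        (((hK.measurable.of_uncurry_left (x := T x)).mul hcm).aestronglyMeasurable)
      rw [hT.map_eq] at this
      exact this.symm
    rw [h1, h2, hκc (T x)]
  -- (4) the `L²` classes `ĉ` of `c` and `ĝ` of `c ∘ T`, both top eigenvectors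
  have hg_mem : MemLp (fun x => c (T x)) 2 μ := by
    refine MemLp.of_bound (hcm.comp hTm).aestronglyMeasurable
      (C * Real.sqrt (μ.real univ) * ‖(b i₀ : Lp ℝ 2 μ)‖) (Eventually.of_forall fun x => ?_)
    rw [Real.norm_eq_abs]
    exact abs_integral_kernel_mul_le hC ((norm_nonneg _).trans (hC x x)) (b i₀) (T x)
  set ĝ : Lp ℝ 2 μ := hg_mem.toLp _ with hĝ
  have hĝae : (ĝ : X → ℝ) =ᵐ[μ] fun x => c (T x) := hg_mem.coeFn_toLp
  set ĉ : Lp ℝ 2 μ := (memLp_two_integral_kernel_mul hK hC (b i₀)).toLp _ with hĉ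
  have hĉae : (ĉ : X → ℝ) =ᵐ[μ] c := (memLp_two_integral_kernel_mul hK hC (b i₀)).coeFn_toLp
  have hAĝ : A ĝ = ‖A‖ • ĝ := by
    refine Lp.ext ?_
    filter_upwards [hA ĝ, hĝae, Lp.coeFn_smul ‖A‖ ĝ] with x hx hgx hsx
    rw [hx, hsx, Pi.smul_apply, smul_eq_mul, hgx, ← hi₀, ← hκg x]
    exact integral_congr_ae (by filter_upwards [hĝae] with y hy; rw [hy])
  have hAĉ : A ĉ = ‖A‖ • ĉ := by
    rw [hĉeq, map_smul, hb, hi₀]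
  have hĉne : ĉ ≠ 0 := by
    rw [hĉeq]
    exact smul_ne_zero hlam₀ (b.orthonormal.ne_zero i₀)
  have hμ : μ ≠ 0 := measure_ne_zero_of_ne_zero hĉne
  -- (5) Perron–Frobenius: the top eigenspace is spanned by an a.e.-positive unit vector `φ`
  have hsa := isSelfAdjoint_kernelOp hK hC hsymm hA
  have hImp := isPositivityImproving_kernelOp hK hC hKpos hA
  obtain ⟨φ, hφ1, hφpos, -, hspan⟩ := hImp.simple_top_eigenvalue hsa ⟨ĉ, hĉne, hAĉ⟩
  have hĉφ : ĉ = ⟪φ, ĉ⟫ • φ := hspan ĉ hAĉ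
  have hĝφ : ĝ = ⟪φ, ĝ⟫ • φ := hspan ĝ hAĝ
  set a' : ℝ := ⟪φ, ĉ⟫ with ha'
  set a : ℝ := ⟪φ, ĝ⟫ with ha
  -- (6) the integral is `⟪ĝ, ĉ⟫ = a a'`
  have hint : ∫ x, c (T x) * c x ∂μ = ⟪ĝ, ĉ⟫ := by
    rw [inner_eq_integral]
    exact integral_congr_ae (by filter_upwards [hĝae, hĉae] with x h1 h2; rw [h1, h2])
  have hinner : ⟪ĝ, ĉ⟫ = a * a' := by
    rw [hĝφ, hĉφ, real_inner_smul_left, real_inner_smul_right, real_inner_self_eq_norm_sq, hφ1]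
    ring
  -- (7) moduli: `|a'| = |a| = |λ₀|`
  have hnorm_smul : ∀ r : ℝ, ‖r • φ‖ = |r| := fun r => by
    rw [norm_smul, Real.norm_eq_abs, hφ1, mul_one]
  have habs_a' : |a'| = |lam i₀| := by
    rw [← hnorm_smul, ← hĉφ, hĉeq, norm_smul, Real.norm_eq_abs, b.orthonormal.norm_eq_one i₀, mul_one]
  have hcomp : ∫ x, c (T x) ^ 2 ∂μ = ∫ x, c x ^ 2 ∂μ := by
    have h := integral_map (μ := μ) hTm.aemeasurable (f := fun y => c y ^ 2)
      ((hcm.pow_const 2).aestronglyMeasurable)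
    rw [hT.map_eq] at h
    exact h.symm
  have hĝnorm : ‖ĝ‖ ^ 2 = lam i₀ ^ 2 := by
    rw [hĝ, norm_toLp_sq_eq_integral_norm_sq (𝕜 := ℝ)]
    simp only [Real.norm_eq_abs, sq_abs]
    rw [hcomp, integral_sq_integral_kernel_mul_basis hK hC hA hb i₀]
  have habs_a : |a| = |lam i₀| := by
    have h1 : |a| = ‖ĝ‖ := by rw [← hnorm_smul, ← hĝφ]
    rw [h1]
    exact (sq_eq_sq₀ (norm_nonneg _) (abs_nonneg _)).1 (by rw [hĝnorm, sq_abs])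
  -- (8) sign: `a = a' · ∫ φ (φ∘T)` and `∫ φ (φ∘T) > 0`
  have hφT_mem : MemLp ((φ : X → ℝ) ∘ T) 2 μ := (Lp.memLp φ).comp_measurePreserving hT
  set φT : Lp ℝ 2 μ := hφT_mem.toLp _ with hφT
  have hφTae : (φT : X → ℝ) =ᵐ[μ] (φ : X → ℝ) ∘ T := hφT_mem.coeFn_toLp
  have hφTpos : IsStrictlyPositiveFun φT := by
    unfold IsStrictlyPositiveFun
    filter_upwards [hφTae, hqmp.ae hφpos] with x hx hpx
    rw [hx]
    exact hpx
  have hP : 0 < ⟪φT, φ⟫ := inner_pos (hφTpos.isPositiveFun hμ) hφpos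
  have hPint : ⟪φT, φ⟫ = ∫ x, φ (T x) * φ x ∂μ := by
    rw [inner_eq_integral]
    exact integral_congr_ae (by filter_upwards [hφTae] with x hx; rw [hx, Function.comp_apply])
  have hcTae : (fun x => c (T x)) =ᵐ[μ] fun x => a' * φ (T x) := by
    have h1 : c =ᵐ[μ] fun x => a' * φ x := by
      have h2 : ((a' • φ : Lp ℝ 2 μ) : X → ℝ) =ᵐ[μ] c := by rw [← hĉφ]; exact hĉae
      filter_upwards [h2, Lp.coeFn_smul a' φ] with x hx hs
      rw [← hx, hs, Pi.smul_apply, smul_eq_mul]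
    exact hqmp.ae_eq_comp h1
  have ha_eq : a = a' * ⟪φT, φ⟫ := by
    rw [hPint, ha, inner_eq_integral, ← integral_const_mul]
    refine integral_congr_ae ?_
    filter_upwards [hĝae, hcTae] with x h1 h2
    rw [h1, h2]
    ring
  -- (9) conclusion
  have hprod_nonneg : 0 ≤ a * a' := by
    rw [ha_eq]
    have : a' * ⟪φT, φ⟫ * a' = a' ^ 2 * ⟪φT, φ⟫ := by ring
    rw [this]
    positivity
  rw [hint, hinner, ← abs_of_nonneg hprod_nonneg, abs_mul, habs_a, habs_a', ← sq, sq_abs]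

omit [CommGroup Zc] [Fintype Zc] in
/-- **The kernel-level twisted spectral datum** (discharge of `[TTF-ℝ]` modulo time-slicing).  For a positive,
positive-type (`λᵢ ≥ 0`) symmetric bounded kernel with top index `i₀` (`λ_{i₀} = ‖A‖ ≠ 0`) and a family of
measure-preserving `K`-invariant twists `T c` (`c : Tw`, `T 1 = id`), ANY family of numbers `z c τ` that agrees
at `τ = m+2` with the twisted cyclic kernel integrals `∫ (κ^{[m+1]} K(·,x))(T c x) dμ(x)` carries a
`HasRealTwistedSpectralDatum` (with `κ i c = ∫ (κbᵢ)∘(T c) · κbᵢ dμ / λᵢ²`). -/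
theorem hasRealTwistedSpectralDatum_of_kernel [Countable ι] {Tw : Type} [One Tw]
    (hK : StronglyMeasurable (uncurry K)) (hC : ∀ x y, ‖K x y‖ ≤ C)
    (hsymm : ∀ x y, K x y = K y x) (hKpos : ∀ x y, 0 < K x y)
    (hA : ∀ φ : Lp ℝ 2 μ, (A φ : X → ℝ) =ᵐ[μ] fun x => ∫ y, K x y * φ y ∂μ)
    (hb : ∀ i, A (b i) = lam i • b i) (hlam : ∀ i, 0 ≤ lam i) {i₀ : ι} (hi₀ : lam i₀ = ‖A‖)
    (hlam₀ : lam i₀ ≠ 0) (T : Tw → X → X) (hT1 : T 1 = id) (hT : ∀ c, MeasurePreserving (T c) μ μ)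
    (hKT : ∀ c x y, K (T c x) (T c y) = K x y) {z : Tw → ℕ → ℝ}
    (hz : ∀ c m, z c (m + 2) =
      ∫ x, ((fun f : X → ℝ => fun w => ∫ y, K w y * f y ∂μ)^[m + 1] (fun y => K y x)) (T c x) ∂μ) :
    HasRealTwistedSpectralDatum z := by
  have hlam₀pos : 0 < lam i₀ := lt_of_le_of_ne (hlam i₀) (Ne.symm hlam₀)
  refine ⟨ι, lam, i₀, fun i c => if lam i = 0 then 1 else
      (∫ x, (∫ y, K (T c x) y * b i y ∂μ) * (∫ y, K x y * b i y ∂μ) ∂μ) / lam i ^ 2,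
    fun i => ⟨hlam i, ?_⟩, hlam₀pos, fun i c => ?_, fun c => ?_, fun m => ?_, fun c m => ?_⟩
  · -- `λᵢ ≤ λ_{i₀} = ‖A‖`
    rw [hi₀]
    exact (le_abs_self _).trans (abs_lam_le_norm hb i)
  · -- `|κ i c| ≤ 1`
    dsimp only
    by_cases h : lam i = 0
    · rw [if_pos h, abs_one]
    · rw [if_neg h, abs_div, abs_of_nonneg (sq_nonneg (lam i)),
        div_le_one (pow_pos (lt_of_le_of_ne (hlam i) (Ne.symm h)) 2)]
      exact abs_integral_twisted_coeff_le hK hC hA hb (hT c) i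
  · -- `κ i₀ c = 1`
    dsimp only
    rw [if_neg hlam₀, integral_twisted_coeff_top hK hC hsymm hKpos hA hb (hT c) (hKT c) hi₀ hlam₀,
      div_self (pow_ne_zero 2 hlam₀)]
  · -- untwisted trace formula
    have hAm := hasSum_pow_integral_iterate_twisted hK hC hsymm hA hb (hT 1).measurable m
    have hfun : (fun i => lam i ^ m *
        ∫ x, (∫ y, K (T 1 x) y * b i y ∂μ) * (∫ y, K x y * b i y ∂μ) ∂μ) = fun i => lam i ^ (m + 2) := by
      funext i
      rw [hT1]
      simp only [id_eq]
      have h2 : ∫ x, (∫ y, K x y * b i y ∂μ) * (∫ y, K x y * b i y ∂μ) ∂μ = lam i ^ 2 := by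
        rw [← integral_sq_integral_kernel_mul_basis hK hC hA hb i]
        exact integral_congr_ae (Eventually.of_forall fun x => by ring)
      rw [h2, ← pow_add]
    rw [hfun] at hAm
    rwa [hz 1 m]
  · -- twisted trace formula
    have hAm := hasSum_pow_integral_iterate_twisted hK hC hsymm hA hb (hT c).measurable m
    rw [hz c m]
    convert hAm using 1
    funext i
    dsimp only
    by_cases h : lam i = 0
    · have hI := abs_integral_twisted_coeff_le hK hC hA hb (hT c) i
      rw [h] at hI
      have hI0 : ∫ x, (∫ y, K (T c x) y * b i y ∂μ) * (∫ y, K x y * b i y ∂μ) ∂μ = 0 :=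
        abs_nonpos_iff.1 (by simpa using hI)
      rw [if_pos h, h, hI0]
      simp
    · rw [if_neg h]
      field_simp
      ring

omit [CommGroup Zc] [Fintype Zc] in
/-- **Purity ⇒ every twist is cheap, kernel level.**  Under the hypotheses of
`hasRealTwistedSpectralDatum_of_kernel`: if the untwisted traces are pure at `(t, 2t)`, `t = m+2`
(`1 - z 1 (2t) / (z 1 t)² ≤ θ`), then EVERY twist costs at most `2θ` at times `t` and `2t`. -/
theorem twist_cost_le_of_pure_kernel [Countable ι] {Tw : Type} [One Tw]
    (hK : StronglyMeasurable (uncurry K)) (hC : ∀ x y, ‖K x y‖ ≤ C)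
    (hsymm : ∀ x y, K x y = K y x) (hKpos : ∀ x y, 0 < K x y)
    (hA : ∀ φ : Lp ℝ 2 μ, (A φ : X → ℝ) =ᵐ[μ] fun x => ∫ y, K x y * φ y ∂μ)
    (hb : ∀ i, A (b i) = lam i • b i) (hlam : ∀ i, 0 ≤ lam i) {i₀ : ι} (hi₀ : lam i₀ = ‖A‖)
    (hlam₀ : lam i₀ ≠ 0) (T : Tw → X → X) (hT1 : T 1 = id) (hT : ∀ c, MeasurePreserving (T c) μ μ)
    (hKT : ∀ c x y, K (T c x) (T c y) = K x y) {z : Tw → ℕ → ℝ}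
    (hz : ∀ c m, z c (m + 2) =
      ∫ x, ((fun f : X → ℝ => fun w => ∫ y, K w y * f y ∂μ)^[m + 1] (fun y => K y x)) (T c x) ∂μ)
    {θ : ℝ} (m : ℕ) (hpure : 1 - z 1 (2 * (m + 2)) / z 1 (m + 2) ^ 2 ≤ θ) (c : Tw) :
    1 - z c (m + 2) / z 1 (m + 2) ≤ 2 * θ ∧ 1 - z c (2 * (m + 2)) / z 1 (2 * (m + 2)) ≤ 2 * θ :=
  twist_cost_le_of_pure_real
    (hasRealTwistedSpectralDatum_of_kernel hK hC hsymm hKpos hA hb hlam hi₀ hlam₀ T hT1 hT hKT hz) m hpure c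

omit [IsFiniteMeasure μ] [CommGroup Zc] [Fintype Zc] in
/-- **Cyclic (path-integral) form of the twisted trace.**  The periodic chain of `M + 2` slice kernels whose closing
bond `V 0 → V 1` is twisted, `K (T (V 0)) (V 1)`, equals the twisted diagonal iterate `∫ (κ^{[M+1]} K(·,x))(T x) dμ(x)`
(the shape a twisted time-slicing theorem «`Z^{(c)} = ∫ ∏ₜ Kₜ(V t, V (t+1))`, `K₀ = K(T_c ·, ·)`» delivers;
`Literature.Analysis.OperatorTheory.integral_cyclic_insert_one` with the bond kernel `X = K(T·, ·)`). -/
theorem integral_cyclic_twisted_eq_integral_iterate [IsFiniteMeasure μ] (hK : StronglyMeasurable (uncurry K))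
    (hC : ∀ x y, ‖K x y‖ ≤ C) {T : X → X} (hTm : Measurable T) (M : ℕ) :
    ∫ V : Fin (1 + M + 1) → X, K (T (V 0)) (V 1) * ∏ t : Fin (1 + M), K (V t.succ) (V (t.succ + 1))
        ∂(Measure.pi fun _ => μ) =
      ∫ x, ((fun f : X → ℝ => fun w => ∫ y, K w y * f y ∂μ)^[M + 1] (fun y => K y x)) (T x) ∂μ := by
  have hX : Measurable (uncurry fun x y => K (T x) y) := by
    have h : (uncurry fun x y => K (T x) y) = uncurry K ∘ Prod.map T id := by
      funext p; rfl
    rw [h]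
    exact hK.measurable.comp (hTm.prodMap measurable_id)
  rw [integral_cyclic_insert_one (ρ := μ) (X := fun x y => K (T x) y) (K := K) hX hK.measurable
    (fun x y => hC (T x) y) hC M]
  refine integral_congr_ae (Eventually.of_forall fun x => ?_)
  dsimp only
  rw [Function.iterate_succ_apply']

omit [CommGroup Zc] [Fintype Zc] in
/-- **Purity ⇒ every twist is cheap, kernel level, CYCLIC form** — `twist_cost_le_of_pure_kernel` with the hypothesis `hz`
in the periodic-chain form a twisted time-slicing theorem delivers. -/
theorem twist_cost_le_of_pure_kernel_cyclic [Countable ι] {Tw : Type} [One Tw]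
    (hK : StronglyMeasurable (uncurry K)) (hC : ∀ x y, ‖K x y‖ ≤ C)
    (hsymm : ∀ x y, K x y = K y x) (hKpos : ∀ x y, 0 < K x y)
    (hA : ∀ φ : Lp ℝ 2 μ, (A φ : X → ℝ) =ᵐ[μ] fun x => ∫ y, K x y * φ y ∂μ)
    (hb : ∀ i, A (b i) = lam i • b i) (hlam : ∀ i, 0 ≤ lam i) {i₀ : ι} (hi₀ : lam i₀ = ‖A‖)
    (hlam₀ : lam i₀ ≠ 0) (T : Tw → X → X) (hT1 : T 1 = id) (hT : ∀ c, MeasurePreserving (T c) μ μ)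
    (hKT : ∀ c x y, K (T c x) (T c y) = K x y) {z : Tw → ℕ → ℝ}
    (hz : ∀ c m, z c (m + 2) = ∫ V : Fin (1 + m + 1) → X,
      K (T c (V 0)) (V 1) * ∏ t : Fin (1 + m), K (V t.succ) (V (t.succ + 1)) ∂(Measure.pi fun _ => μ))
    {θ : ℝ} (m : ℕ) (hpure : 1 - z 1 (2 * (m + 2)) / z 1 (m + 2) ^ 2 ≤ θ) (c : Tw) :
    1 - z c (m + 2) / z 1 (m + 2) ≤ 2 * θ ∧ 1 - z c (2 * (m + 2)) / z 1 (2 * (m + 2)) ≤ 2 * θ :=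
  twist_cost_le_of_pure_kernel hK hC hsymm hKpos hA hb hlam hi₀ hlam₀ T hT1 hT hKT
    (fun c m => (hz c m).trans (integral_cyclic_twisted_eq_integral_iterate hK hC (hT c).measurable m)) m hpure c

omit [CommGroup Zc] [Fintype Zc] in
/-- **Untwisted trace formula in the one-marked-bond convention**: `Σ λᵢ^{M+2} = ∫ K(V₀,V₁) ∏ K(V_{t+1},V_{t+2}) dV` over
`Fin (1+M+1)` (the `T = id` case of `hasSum_pow_integral_iterate_twisted` + the cyclic bridge; used to identify the untwisted
member of a sliced twisted family with the partition function). -/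
theorem hasSum_pow_integral_cyclic_one [Countable ι] (hK : StronglyMeasurable (uncurry K))
    (hC : ∀ x y, ‖K x y‖ ≤ C) (hsymm : ∀ x y, K x y = K y x)
    (hA : ∀ φ : Lp ℝ 2 μ, (A φ : X → ℝ) =ᵐ[μ] fun x => ∫ y, K x y * φ y ∂μ)
    (hb : ∀ i, A (b i) = lam i • b i) (M : ℕ) :
    HasSum (fun i => lam i ^ (M + 2))
      (∫ V : Fin (1 + M + 1) → X, K (V 0) (V 1) * ∏ t : Fin (1 + M), K (V t.succ) (V (t.succ + 1))
        ∂(Measure.pi fun _ => μ)) := by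
  have h := hasSum_pow_integral_iterate_twisted hK hC hsymm hA hb measurable_id M
  have hbr := integral_cyclic_twisted_eq_integral_iterate (μ := μ) hK hC (T := id) measurable_id M
  simp only [id_eq] at h hbr
  have hco : ∀ i, ∫ x, (∫ z, K x z * b i z ∂μ) * (∫ z, K x z * b i z ∂μ) ∂μ = lam i ^ 2 := fun i => by
    rw [← integral_sq_integral_kernel_mul_basis hK hC hA hb i]
    exact integral_congr_ae (Eventually.of_forall fun x => (sq _).symm)
  have hfun : (fun i => lam i ^ M * ∫ x, (∫ z, K x z * b i z ∂μ) * (∫ z, K x z * b i z ∂μ) ∂μ) =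
      fun i => lam i ^ (M + 2) := funext fun i => by rw [hco, pow_add]
  rw [hfun] at h
  rwa [hbr]

omit [CommGroup Zc] [Fintype Zc] in
/-- **A twist never raises the trace**: `∫ (κ^{[M+1]}K(·,x))(T x) dμ ≤ ∫ (κ^{[M+1]}K(·,x))(x) dμ` for a measure-preserving `T`
(`λᵢ ≥ 0`, `|∫ (κbᵢ)∘T·κbᵢ| ≤ λᵢ² = ∫ (κbᵢ)²`; i.e. `Z^{tw} ≤ Z`, `|κᵢ(c)| ≤ 1`). -/
theorem integral_iterate_twisted_le [Countable ι] (hK : StronglyMeasurable (uncurry K))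
    (hC : ∀ x y, ‖K x y‖ ≤ C) (hsymm : ∀ x y, K x y = K y x)
    (hA : ∀ φ : Lp ℝ 2 μ, (A φ : X → ℝ) =ᵐ[μ] fun x => ∫ y, K x y * φ y ∂μ)
    (hb : ∀ i, A (b i) = lam i • b i) (hlam : ∀ i, 0 ≤ lam i) {T : X → X} (hT : MeasurePreserving T μ μ)
    (M : ℕ) :
    ∫ x, ((fun f : X → ℝ => fun w => ∫ z, K w z * f z ∂μ)^[M + 1] (fun z => K z x)) (T x) ∂μ ≤
      ∫ x, ((fun f : X → ℝ => fun w => ∫ z, K w z * f z ∂μ)^[M + 1] (fun z => K z x)) x ∂μ := by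
  have h1 := hasSum_pow_integral_iterate_twisted hK hC hsymm hA hb hT.measurable M
  have h2 := hasSum_pow_integral_iterate_twisted hK hC hsymm hA hb measurable_id M
  simp only [id_eq] at h2
  refine hasSum_le (fun i => ?_) h1 h2
  have hco : ∫ x, (∫ z, K x z * b i z ∂μ) * (∫ z, K x z * b i z ∂μ) ∂μ = lam i ^ 2 := by
    rw [← integral_sq_integral_kernel_mul_basis hK hC hA hb i]
    exact integral_congr_ae (Eventually.of_forall fun x => (sq _).symm)
  rw [hco]
  exact mul_le_mul_of_nonneg_left ((le_abs_self _).trans (abs_integral_twisted_coeff_le hK hC hA hb hT i))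
    (pow_nonneg (hlam i) M)

omit [CommGroup Zc] [Fintype Zc] in
/-- Cyclic-chain form of `integral_iterate_twisted_le`: twisting the closing bond never raises the chain integral. -/
theorem integral_cyclic_twisted_le [Countable ι] (hK : StronglyMeasurable (uncurry K))
    (hC : ∀ x y, ‖K x y‖ ≤ C) (hsymm : ∀ x y, K x y = K y x)
    (hA : ∀ φ : Lp ℝ 2 μ, (A φ : X → ℝ) =ᵐ[μ] fun x => ∫ y, K x y * φ y ∂μ)
    (hb : ∀ i, A (b i) = lam i • b i) (hlam : ∀ i, 0 ≤ lam i) {T : X → X} (hT : MeasurePreserving T μ μ)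
    (M : ℕ) :
    ∫ V : Fin (1 + M + 1) → X, K (T (V 0)) (V 1) * ∏ t : Fin (1 + M), K (V t.succ) (V (t.succ + 1))
        ∂(Measure.pi fun _ => μ) ≤
      ∫ V : Fin (1 + M + 1) → X, K (V 0) (V 1) * ∏ t : Fin (1 + M), K (V t.succ) (V (t.succ + 1))
        ∂(Measure.pi fun _ => μ) := by
  have hbr := integral_cyclic_twisted_eq_integral_iterate (μ := μ) hK hC (T := id) measurable_id M
  simp only [id_eq] at hbr
  rw [integral_cyclic_twisted_eq_integral_iterate (μ := μ) hK hC hT.measurable M, hbr]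
  exact integral_iterate_twisted_le hK hC hsymm hA hb hlam hT M

end Kernel

/-! ## §5 Wilson's slice: the central temporal-twist map (located, model-specific; the hypotheses `hT`, `hKT` of §4)

For the Wilson time slice `a : FinSpatialSite b₁ b₂ b₃ × Fin 3 → G` (spatial links) the temporal twist by central
elements `z : Fin 3 → G` is the map `sliceTwist z`: multiply the `i`-links based on the plane `{p : p_i = 0}` by `z i`.
We prove: it preserves the product Haar measure (`measurePreserving_sliceTwist`), and for CENTRAL `z` it leaves the
spatial plaquette energy, the temporal plaquette energy (jointly in the two slices) and hence the slice kernel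
`finTorusSliceKernel` invariant (`finTorusSliceKernel_sliceTwist`) — every plaquette contains 0 or 2 oppositely oriented
twisted links.  The twisted kernel `finTorusSliceKernel ρ β (sliceTwist z a) b` is idea-10's twist: `z i` inserted in the
temporal plaquettes `(p, i, 3)` with `p_i = 0` of ONE slab (`twistFactor`, `x₃ = 0`).  What remains for `twistedColdZ` is
the twisted time-slicing identity alone (hypothesis `hz` of `twist_cost_le_of_pure_finTorusSlice`). -/

section WilsonSlice

open MeasureTheory Function
open Literature.MathematicalPhysics.QuantumFieldTheory

variable {b₁ b₂ b₃ : ℕ} {G : Type} [Group G]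

/-- The `i`-th coordinate of a spatial site, as a natural number. -/
def spCoord (p : FinSpatialSite b₁ b₂ b₃) : Fin 3 → ℕ := ![(p.1 : ℕ), (p.2.1 : ℕ), (p.2.2 : ℕ)]

omit [CommGroup Zc] [Fintype Zc] [Group G] in
/-- Shifting a site in direction `j` does not change its `i`-th coordinate, `i ≠ j`. -/
theorem spCoord_shift_of_ne (p : FinSpatialSite b₁ b₂ b₃) {i j : Fin 3} (h : i ≠ j) :
    spCoord (p.shift j) i = spCoord p i := by
  fin_cases i <;> fin_cases j <;> simp_all [FinSpatialSite.shift, spCoord]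

/-- The twist weight of a link `l = (p, i)`: `z i` on the plane `p_i = 0`, else `1`. -/
def sliceTwistWeight (z : Fin 3 → G) (l : FinSpatialSite b₁ b₂ b₃ × Fin 3) : G :=
  if spCoord l.1 l.2 = 0 then z l.2 else 1

/-- **The temporal-twist map of one time slice**: `(sliceTwist z a) l = sliceTwistWeight z l * a l`. -/
def sliceTwist (z : Fin 3 → G) (a : FinSpatialSite b₁ b₂ b₃ × Fin 3 → G) : FinSpatialSite b₁ b₂ b₃ × Fin 3 → G :=
  fun l => sliceTwistWeight z l * a l

omit [CommGroup Zc] [Fintype Zc] in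
theorem sliceTwist_one : sliceTwist (b₁ := b₁) (b₂ := b₂) (b₃ := b₃) (1 : Fin 3 → G) = id := by
  funext a l
  simp [sliceTwist, sliceTwistWeight]

omit [CommGroup Zc] [Fintype Zc] in
theorem sliceTwistWeight_mem_center {z : Fin 3 → G} (hz : ∀ i, z i ∈ Subgroup.center G)
    (l : FinSpatialSite b₁ b₂ b₃ × Fin 3) : sliceTwistWeight z l ∈ Subgroup.center G := by
  unfold sliceTwistWeight
  split
  · exact hz _
  · exact Subgroup.one_mem _

omit [CommGroup Zc] [Fintype Zc] in
/-- The weight of the link `(p + e_j, i)` equals that of `(p, i)` for `i ≠ j` (the plane `p_i = 0` is `e_j`-invariant). -/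
theorem sliceTwistWeight_shift_of_ne (z : Fin 3 → G) (p : FinSpatialSite b₁ b₂ b₃) {i j : Fin 3} (h : i ≠ j) :
    sliceTwistWeight z (p.shift j, i) = sliceTwistWeight z (p, i) := by
  unfold sliceTwistWeight
  dsimp only
  rw [spCoord_shift_of_ne p h]

omit [CommGroup Zc] [Fintype Zc] in
theorem conj_eq_of_mem_center {w : G} (hw : w ∈ Subgroup.center G) (x : G) : w * x * w⁻¹ = x := by
  rw [← Subgroup.mem_center_iff.1 hw x, mul_inv_cancel_right]

omit [CommGroup Zc] [Fintype Zc] in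
/-- A plaquette with two oppositely oriented links twisted by central weights is untwisted. -/
theorem twist_plaquette_cancel {w₁ w₂ : G} (hw₁ : w₁ ∈ Subgroup.center G) (hw₂ : w₂ ∈ Subgroup.center G)
    (a₁ a₂ a₃ a₄ : G) : w₁ * a₁ * (w₂ * a₂) * (w₁ * a₃)⁻¹ * (w₂ * a₄)⁻¹ = a₁ * a₂ * a₃⁻¹ * a₄⁻¹ := by
  calc w₁ * a₁ * (w₂ * a₂) * (w₁ * a₃)⁻¹ * (w₂ * a₄)⁻¹
        = w₁ * (a₁ * w₂ * a₂ * a₃⁻¹) * w₁⁻¹ * a₄⁻¹ * w₂⁻¹ := by group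
    _ = a₁ * w₂ * a₂ * a₃⁻¹ * a₄⁻¹ * w₂⁻¹ := by rw [conj_eq_of_mem_center hw₁]
    _ = a₁ * (w₂ * (a₂ * a₃⁻¹ * a₄⁻¹) * w₂⁻¹) := by group
    _ = a₁ * a₂ * a₃⁻¹ * a₄⁻¹ := by rw [conj_eq_of_mem_center hw₂]; group

omit [CommGroup Zc] [Fintype Zc] in
/-- A temporal plaquette whose two spatial links carry the same central weight is untwisted. -/
theorem twist_temporal_cancel {w : G} (hw : w ∈ Subgroup.center G) (a g b h : G) :
    w * a * g * (w * b)⁻¹ * h⁻¹ = a * g * b⁻¹ * h⁻¹ := by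
  calc w * a * g * (w * b)⁻¹ * h⁻¹ = w * (a * g * b⁻¹) * w⁻¹ * h⁻¹ := by group
    _ = a * g * b⁻¹ * h⁻¹ := by rw [conj_eq_of_mem_center hw]

variable {N : ℕ} (ρ : G →* Matrix (Fin N) (Fin N) ℂ)

omit [CommGroup Zc] [Fintype Zc] in
/-- **The temporal plaquette energy is invariant under twisting BOTH slices** (central `z`). -/
theorem finTorusTemporalAction_sliceTwist {z : Fin 3 → G} (hz : ∀ i, z i ∈ Subgroup.center G)
    (a : FinSpatialSite b₁ b₂ b₃ × Fin 3 → G) (g : FinSpatialSite b₁ b₂ b₃ → G)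
    (b : FinSpatialSite b₁ b₂ b₃ × Fin 3 → G) :
    finTorusTemporalAction ρ (sliceTwist z a) g (sliceTwist z b) = finTorusTemporalAction ρ a g b := by
  unfold finTorusTemporalAction
  refine Finset.sum_congr rfl fun p _ => Finset.sum_congr rfl fun i _ => ?_
  simp only [sliceTwist]
  rw [twist_temporal_cancel (sliceTwistWeight_mem_center hz (p, i))]

omit [CommGroup Zc] [Fintype Zc] in
/-- **The spatial plaquette energy of a slice is twist-invariant** (central `z`; the two `i`-links of an `(i,j)`-plaquette
lie on the same plane `p_i = const`, the two `j`-links on the same plane `p_j = const`). -/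
theorem finTorusSpatialAction_sliceTwist {z : Fin 3 → G} (hz : ∀ i, z i ∈ Subgroup.center G)
    (a : FinSpatialSite b₁ b₂ b₃ × Fin 3 → G) :
    finTorusSpatialAction ρ (sliceTwist z a) = finTorusSpatialAction ρ a := by
  unfold finTorusSpatialAction
  refine Finset.sum_congr rfl fun p _ => Finset.sum_congr rfl fun q _ => ?_
  obtain ⟨⟨i, j⟩, hij⟩ := q
  have hne : i ≠ j := ne_of_lt hij
  simp only [sliceTwist]
  rw [sliceTwistWeight_shift_of_ne z p hne.symm, sliceTwistWeight_shift_of_ne z p hne,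
    twist_plaquette_cancel (sliceTwistWeight_mem_center hz (p, i)) (sliceTwistWeight_mem_center hz (p, j))]

variable [TopologicalSpace G] [IsTopologicalGroup G] [CompactSpace G] [MeasurableSpace G] [BorelSpace G]

omit [CommGroup Zc] [Fintype Zc] in
/-- **The Wilson slice kernel is invariant under the central temporal twist of both arguments.** -/
theorem finTorusSliceKernel_sliceTwist {z : Fin 3 → G} (hz : ∀ i, z i ∈ Subgroup.center G) (β : ℝ)
    (a b : FinSpatialSite b₁ b₂ b₃ × Fin 3 → G) :
    finTorusSliceKernel ρ β (sliceTwist z a) (sliceTwist z b) = finTorusSliceKernel ρ β a b := by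
  unfold finTorusSliceKernel
  simp_rw [finTorusSpatialAction_sliceTwist ρ hz, finTorusTemporalAction_sliceTwist ρ hz]

omit [CommGroup Zc] [Fintype Zc] [TopologicalSpace G] [IsTopologicalGroup G] [CompactSpace G] [BorelSpace G] in
/-- **The twist map preserves the product Haar measure** (left-invariance of Haar, link by link). -/
theorem measurePreserving_sliceTwist [TopologicalSpace G] [IsTopologicalGroup G] [CompactSpace G] [BorelSpace G]
    (z : Fin 3 → G) :
    MeasurePreserving (sliceTwist (b₁ := b₁) (b₂ := b₂) (b₃ := b₃) z)
      (Measure.pi fun _ => haarProbability G) (Measure.pi fun _ => haarProbability G) := by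
  haveI : (haarProbability G).IsMulLeftInvariant := by
    dsimp [haarProbability]; infer_instance
  unfold sliceTwist
  exact measurePreserving_pi (f := fun l (x : G) => sliceTwistWeight z l * x) _ _
    (fun l => measurePreserving_mul_left _ _)

omit [CommGroup Zc] [Fintype Zc] in
/-- **Purity ⇒ every central temporal twist is cheap — Wilson's slice kernel** (the form a typer plugs the twisted
time-slicing identity into).  Data: a continuous unitary representation `ρ`; the transfer operator `A` of the slice kernel
`finTorusSliceKernel ρ β` on `L²` of one slice with an eigenbasis `A bᵢ = λᵢ bᵢ`, `λᵢ ≥ 0`, and a top index `λ_{i₀} = ‖A‖ ≠ 0`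
(exactly what the proof of `exists_spectralData_wilsonFinTorusPartition_box` constructs); numbers `zf c τ` indexed by the central
twists `c : Fin 3 → Subgroup.center G` which at `τ = m+2` equal the periodic chain of slice kernels with the closing bond twisted
(`hz` — for idea-10's `twistedColdZ` this is the OWED twisted analogue of `wilsonFinTorusPartition_eq_integral_prod_finTorusSliceKernel`).
Conclusion: `1 − zf 1 (2t)/(zf 1 t)² ≤ θ ⇒ 1 − zf c t / zf 1 t ≤ 2θ ∧ 1 − zf c (2t) / zf 1 (2t) ≤ 2θ`, `t = m+2`, every `c`. -/
theorem twist_cost_le_of_pure_finTorusSlice [SecondCountableTopology G] (hρ : Continuous ρ)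
    (hρu : ∀ g, ρ g ∈ Matrix.unitaryGroup (Fin N) ℂ) (β : ℝ) {ι : Type} [Countable ι]
    {A : Lp ℝ 2 (Measure.pi fun _ : FinSpatialSite b₁ b₂ b₃ × Fin 3 => haarProbability G) →L[ℝ]
      Lp ℝ 2 (Measure.pi fun _ : FinSpatialSite b₁ b₂ b₃ × Fin 3 => haarProbability G)}
    (hA : ∀ φ : Lp ℝ 2 (Measure.pi fun _ : FinSpatialSite b₁ b₂ b₃ × Fin 3 => haarProbability G),
      (A φ : (FinSpatialSite b₁ b₂ b₃ × Fin 3 → G) → ℝ)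
        =ᵐ[Measure.pi fun _ : FinSpatialSite b₁ b₂ b₃ × Fin 3 => haarProbability G]
      fun x => ∫ y, finTorusSliceKernel ρ β x y * φ y ∂(Measure.pi fun _ => haarProbability G))
    {b : HilbertBasis ι ℝ (Lp ℝ 2 (Measure.pi fun _ : FinSpatialSite b₁ b₂ b₃ × Fin 3 => haarProbability G))}
    {lam : ι → ℝ} (hb : ∀ i, A (b i) = lam i • b i) (hlam : ∀ i, 0 ≤ lam i) {i₀ : ι} (hi₀ : lam i₀ = ‖A‖)
    (hlam₀ : lam i₀ ≠ 0) {zf : (Fin 3 → Subgroup.center G) → ℕ → ℝ}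
    (hz : ∀ (c : Fin 3 → Subgroup.center G) (m : ℕ), zf c (m + 2) =
      ∫ V : Fin (1 + m + 1) → (FinSpatialSite b₁ b₂ b₃ × Fin 3 → G),
        finTorusSliceKernel ρ β (sliceTwist (fun i => (c i : G)) (V 0)) (V 1) *
          ∏ t : Fin (1 + m), finTorusSliceKernel ρ β (V t.succ) (V (t.succ + 1))
        ∂(Measure.pi fun _ => Measure.pi fun _ : FinSpatialSite b₁ b₂ b₃ × Fin 3 => haarProbability G))
    {θ : ℝ} (m : ℕ) (hpure : 1 - zf 1 (2 * (m + 2)) / zf 1 (m + 2) ^ 2 ≤ θ) (c : Fin 3 → Subgroup.center G) :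
    1 - zf c (m + 2) / zf 1 (m + 2) ≤ 2 * θ ∧ 1 - zf c (2 * (m + 2)) / zf 1 (2 * (m + 2)) ≤ 2 * θ := by
  haveI : IsFiniteMeasure (haarProbability G) := by
    dsimp [haarProbability]; infer_instance
  obtain ⟨C, hC⟩ := exists_norm_finTorusSliceKernel_le (b₁ := b₁) (b₂ := b₂) (b₃ := b₃) ρ hρ β
  have hT1 : (fun c : Fin 3 → Subgroup.center G =>
      sliceTwist (b₁ := b₁) (b₂ := b₂) (b₃ := b₃) (fun i => (c i : G))) 1 = id := by
    funext a l
    simp [sliceTwist, sliceTwistWeight]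
  exact twist_cost_le_of_pure_kernel_cyclic (stronglyMeasurable_uncurry_finTorusSliceKernel ρ hρ β) hC
    (finTorusSliceKernel_symm ρ hρu β) (finTorusSliceKernel_pos ρ hρ β) hA hb hlam hi₀ hlam₀
    (fun c : Fin 3 → Subgroup.center G => sliceTwist (fun i => (c i : G))) hT1
    (fun c => measurePreserving_sliceTwist _) (fun c x y => finTorusSliceKernel_sliceTwist ρ (fun i => (c i).2) β x y)
    hz m hpure c

end WilsonSlice

/-! ## §6 The arrow `E(θ) ⇒ F_exit^{sliced}(2θ)` — closed form, no operator hypotheses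

`slicedTwistedZ ρ β b c τ` is the period-`τ` chain of Wilson slice kernels on the box `b₁×b₂×b₃` whose CLOSING bond is twisted by the
central temporal twist `c : Fin 3 → Z(G)` (junk `0` at `τ ≤ 1`).  At `c = 1` it IS the partition function (`slicedTwistedZ_one`:
both are `Σ λᵢ^τ` for the same eigen-data — no re-indexing needed).  `slicedTwist_cost_le_of_purity`: for `β ≥ 0` and a continuous
unitary `ρ`, `1 − Z(2τ)/Z(τ)² ≤ θ ⇒ 1 − Z^{tw}_c(τ)/Z(τ) ≤ 2θ ∧ 1 − Z^{tw}_c(2τ)/Z(2τ) ≤ 2θ` for EVERY central twist `c` — the operator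
data are constructed inside (replay of `exists_spectralData_wilsonFinTorusPartition_box`).  `slicedFluxExitAt_of_coldExitAt`: the bill's
seed `E(θ) = ColdExitAt θ` implies the sliced flux-exit statement at `2θ`, KERNEL-CHECKED.  The only thing between `SlicedFluxExitAt`
and idea-10's plaquette-level `twistedColdZ` is the twisted time-slicing identity (a typer's variant of
`wilsonFinTorusPartition_eq_integral_prod_finTorusSliceKernel`). -/

section Closed

open MeasureTheory Function Filter
open scoped ENNReal
open Literature.Analysis.OperatorTheory Literature.MathematicalPhysics.QuantumFieldTheory

variable {G : Type} [Group G] [TopologicalSpace G] [IsTopologicalGroup G] [CompactSpace G]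
  [MeasurableSpace G] [BorelSpace G] {N : ℕ}

/-- **The sliced twisted partition function** `Z^{tw}_c(b₁×b₂×b₃×τ)`: the cyclic chain of `τ = m+2` slice kernels with the
closing bond `K(T_c V₀, V₁)` twisted (`0` for `τ ≤ 1`). -/
def slicedTwistedZ (ρ : G →* Matrix (Fin N) (Fin N) ℂ) (β : ℝ) (b₁ b₂ b₃ : ℕ) (c : Fin 3 → Subgroup.center G) : ℕ → ℝ
  | 0 => 0
  | 1 => 0
  | m + 2 => ∫ V : Fin (1 + m + 1) → (FinSpatialSite b₁ b₂ b₃ × Fin 3 → G),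
      finTorusSliceKernel ρ β (sliceTwist (fun i => (c i : G)) (V 0)) (V 1) *
        ∏ t : Fin (1 + m), finTorusSliceKernel ρ β (V t.succ) (V (t.succ + 1))
      ∂(Measure.pi fun _ => Measure.pi fun _ : FinSpatialSite b₁ b₂ b₃ × Fin 3 => haarProbability G)

omit [TopologicalSpace G] [IsTopologicalGroup G] [CompactSpace G] [MeasurableSpace G] [BorelSpace G] [CommGroup Zc]
  [Fintype Zc] in
theorem sliceTwist_coe_one {b₁ b₂ b₃ : ℕ} (a : FinSpatialSite b₁ b₂ b₃ × Fin 3 → G) :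
    sliceTwist (fun i => ((1 : Fin 3 → Subgroup.center G) i : G)) a = a := by
  funext l
  simp [sliceTwist, sliceTwistWeight]

omit [CommGroup Zc] [Fintype Zc] in
/-- **Purity ⇒ every central temporal twist is cheap, closed form.**  `β ≥ 0`, continuous unitary `ρ`, any box, any `m`:
`1 − Z(2(m+2))/Z(m+2)² ≤ θ ⇒ ∀ c, 1 − Z^{tw}_c(m+2)/Z(m+2) ≤ 2θ ∧ 1 − Z^{tw}_c(2(m+2))/Z(2(m+2)) ≤ 2θ`; and `Z^{tw}_1 = Z`. -/
theorem slicedTwist_cost_le_of_purity [SecondCountableTopology G] {ρ : G →* Matrix (Fin N) (Fin N) ℂ}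
    (hρ : Continuous ρ) (hρu : ∀ g, ρ g ∈ Matrix.unitaryGroup (Fin N) ℂ) {β : ℝ} (hβ : 0 ≤ β) (b₁ b₂ b₃ m : ℕ)
    {θ : ℝ} (hpure : 1 - wilsonFinTorusPartition ρ β b₁ b₂ b₃ (2 * (m + 2)) /
      wilsonFinTorusPartition ρ β b₁ b₂ b₃ (m + 2) ^ 2 ≤ θ) (c : Fin 3 → Subgroup.center G) :
    (∀ n : ℕ, slicedTwistedZ ρ β b₁ b₂ b₃ 1 (n + 2) = wilsonFinTorusPartition ρ β b₁ b₂ b₃ (n + 2)) ∧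
    (∀ n : ℕ, slicedTwistedZ ρ β b₁ b₂ b₃ c (n + 2) ≤ wilsonFinTorusPartition ρ β b₁ b₂ b₃ (n + 2)) ∧
    1 - slicedTwistedZ ρ β b₁ b₂ b₃ c (m + 2) / wilsonFinTorusPartition ρ β b₁ b₂ b₃ (m + 2) ≤ 2 * θ ∧
    1 - slicedTwistedZ ρ β b₁ b₂ b₃ c (2 * (m + 2)) / wilsonFinTorusPartition ρ β b₁ b₂ b₃ (2 * (m + 2)) ≤ 2 * θ := by
  haveI : IsFiniteMeasure (haarProbability G) := by
    dsimp [haarProbability]; infer_instance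
  set μ : Measure (FinSpatialSite b₁ b₂ b₃ × Fin 3 → G) :=
    Measure.pi fun _ : FinSpatialSite b₁ b₂ b₃ × Fin 3 => haarProbability G with hμ
  -- the operator data (replay of `exists_spectralData_wilsonFinTorusPartition_box`)
  have hK := stronglyMeasurable_uncurry_finTorusSliceKernel (b₁ := b₁) (b₂ := b₂) (b₃ := b₃) ρ hρ β
  obtain ⟨C, hC⟩ := exists_norm_finTorusSliceKernel_le (b₁ := b₁) (b₂ := b₂) (b₃ := b₃) ρ hρ β
  have hsymm : ∀ x y : FinSpatialSite b₁ b₂ b₃ × Fin 3 → G,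
      finTorusSliceKernel ρ β x y = finTorusSliceKernel ρ β y x := finTorusSliceKernel_symm ρ hρu β
  have hKpos : ∀ x y : FinSpatialSite b₁ b₂ b₃ × Fin 3 → G, 0 < finTorusSliceKernel ρ β x y :=
    finTorusSliceKernel_pos ρ hρ β
  obtain ⟨A, hA⟩ := exists_kernelOp (μ := μ) hK hC
  have hsa : IsSelfAdjoint A := isSelfAdjoint_kernelOp hK hC hsymm hA
  have hC0 : 0 ≤ C := (norm_nonneg _).trans (hC 1 1)
  have hcpt : IsCompactOperator A := isCompactOperator_kernelOp hC hC0 hA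
  have himp : IsPositivityImproving A := isPositivityImproving_kernelOp hK hC hKpos hA
  have hA0 : A ≠ 0 := kernelOp_ne_zero hK hC hKpos (IsProbabilityMeasure.ne_zero _) hA
  obtain ⟨s, b, lam, hbs, hb0⟩ := exists_hilbertBasis_eigenvectors_of_isSelfAdjoint hcpt hsa
  have hb : ∀ i, A (b i) = lam i • b i := fun i => by simpa using hb0 i
  haveI : Fact ((2 : ℝ≥0∞) ≠ ⊤) := ⟨ENNReal.ofNat_ne_top⟩
  have hon : Orthonormal ℝ ((↑) : s → Lp ℝ 2 μ) := hbs ▸ b.orthonormal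
  haveI : Countable s := (hon.countable_of_separableSpace (𝕜 := ℝ)).to_subtype
  have hlam0 : ∀ i, 0 ≤ lam i := fun i => by
    rw [lam_eq_inner hb i]
    exact inner_kernelOp_self_nonneg hA (posType_finTorusSliceKernel ρ hρ hρu hβ) _
  obtain ⟨ψ, hψ0, hψ⟩ := himp.exists_top_eigenvector_of_isCompactOperator hsa hcpt hA0
  obtain ⟨i₀, hi₀⟩ := exists_index_eq_norm b hsa hb hψ0 hψ
  have hL0 : lam i₀ ≠ 0 := by rw [hi₀]; exact norm_ne_zero_iff.2 hA0
  -- the untwisted member is the partition function (both are `Σ λᵢ^{n+2}` for THIS eigen-data)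
  have hZ1 : ∀ n : ℕ, slicedTwistedZ ρ β b₁ b₂ b₃ 1 (n + 2) = wilsonFinTorusPartition ρ β b₁ b₂ b₃ (n + 2) := by
    intro n
    have h1 : HasSum (fun i => lam i ^ (n + 2)) (wilsonFinTorusPartition ρ β b₁ b₂ b₃ (n + 2)) := by
      rw [wilsonFinTorusPartition_eq_integral_prod_finTorusSliceKernel_succ ρ hρ β b₁ b₂ b₃ n]
      exact hasSum_pow_integral_cyclic hK hC hsymm hA hb hlam0 n
    have h2 : HasSum (fun i => lam i ^ (n + 2)) (slicedTwistedZ ρ β b₁ b₂ b₃ 1 (n + 2)) := by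
      have h := hasSum_pow_integral_cyclic_one hK hC hsymm hA hb n
      simp only [slicedTwistedZ, sliceTwist_coe_one]
      exact h
    exact h2.unique h1
  have hZ1' : slicedTwistedZ ρ β b₁ b₂ b₃ 1 (2 * (m + 2)) = wilsonFinTorusPartition ρ β b₁ b₂ b₃ (2 * (m + 2)) := by
    rw [show 2 * (m + 2) = 2 * m + 2 + 2 by ring]
    exact hZ1 _
  have key := twist_cost_le_of_pure_finTorusSlice (b₁ := b₁) (b₂ := b₂) (b₃ := b₃) ρ hρ hρu β hA hb hlam0 hi₀ hL0
    (zf := slicedTwistedZ ρ β b₁ b₂ b₃) (fun c m => by simp only [slicedTwistedZ]) (θ := θ) m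
    (by rw [hZ1 m, hZ1']; exact hpure) c
  rw [hZ1 m, hZ1'] at key
  have hup : ∀ n : ℕ, slicedTwistedZ ρ β b₁ b₂ b₃ c (n + 2) ≤ wilsonFinTorusPartition ρ β b₁ b₂ b₃ (n + 2) := by
    intro n
    rw [← hZ1 n]
    simp only [slicedTwistedZ, sliceTwist_coe_one]
    exact integral_cyclic_twisted_le hK hC hsymm hA hb hlam0 (measurePreserving_sliceTwist _) n
  exact ⟨hZ1, hup, key⟩

/-- **`F_exit^{sliced}(θ)` — exit-form confined temporal twist, sliced version.**  Same binders as `BasinRung.ColdExitAt`: for every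
simply connected compact simple `G` and faithful unitary `r`, at all large `β`, at SOME scale `L ≥ 8`, EVERY central temporal twist
`c` of the cold boxes `L³ × ⌊L/4⌋` and `L³ × 2⌊L/4⌋` costs at most `θ`: `1 − Z^{tw}_c/Z ≤ θ`. -/
def SlicedFluxExitAt (θ : ℝ) : Prop :=
  ∀ (G : Type) [Group G] [TopologicalSpace G] [IsTopologicalGroup G] [CompactSpace G],
    IsCompactSimpleLieGroup G → SimplyConnectedSpace G →
    letI : MeasurableSpace G := borel G; haveI : BorelSpace G := ⟨rfl⟩;
    ∀ r : LatticeRep G, ∃ β₁ : ℝ, ∀ β : ℝ, β₁ ≤ β → ∃ L : ℕ, 8 ≤ L ∧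
      ∀ c : Fin 3 → Subgroup.center G,
        1 - slicedTwistedZ r.ρ β L L L c (L / 4) / wilsonFinTorusPartition r.ρ β L L L (L / 4) ≤ θ ∧
        1 - slicedTwistedZ r.ρ β L L L c (2 * (L / 4)) / wilsonFinTorusPartition r.ρ β L L L (2 * (L / 4)) ≤ θ

omit [CommGroup Zc] [Fintype Zc] in
/-- **THE ARROW `E(θ) ⇒ F_exit^{sliced}(2θ)`, kernel-checked**: the bill's seed `ColdExitAt θ` (purity defect `≤ θ` at some cold
scale, all large `β`) forces every central temporal twist of those cold boxes to cost at most `2θ`. -/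
theorem slicedFluxExitAt_of_coldExitAt {θ : ℝ} (hE : BasinRung.ColdExitAt θ) : SlicedFluxExitAt (2 * θ) := by
  intro G _ _ _ _ hG hsc
  letI : MeasurableSpace G := borel G
  haveI : BorelSpace G := ⟨rfl⟩
  intro r
  haveI : SecondCountableTopology G :=
    (r.continuous.isClosedEmbedding r.injective).isEmbedding.secondCountableTopology
  obtain ⟨β₁, hβ₁⟩ := hE G hG hsc r
  refine ⟨max β₁ 0, fun β hβ => ?_⟩
  obtain ⟨L, hL, hδ⟩ := hβ₁ β ((le_max_left _ _).trans hβ)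
  have hβ0 : 0 ≤ β := (le_max_right _ _).trans hβ
  refine ⟨L, hL, fun c => ?_⟩
  obtain ⟨m, hm⟩ : ∃ m : ℕ, L / 4 = m + 2 := ⟨L / 4 - 2, by omega⟩
  have hδ' : 1 - wilsonFinTorusPartition r.ρ β L L L (2 * (m + 2)) /
      wilsonFinTorusPartition r.ρ β L L L (m + 2) ^ 2 ≤ θ := by
    have h := hδ
    unfold ColdPurityBridge.coldDefect at h
    rwa [hm] at h
  rw [hm]
  exact (slicedTwist_cost_le_of_purity r.continuous r.mem_unitary hβ0 L L L m hδ' c).2.2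

end Closed

/-! ## §7 Plaquette level: idea-10's `twistedColdZ` IS the sliced twisted chain — the twisted time-slicing identity, and `E ⇒ F_exit`

`siteCoord`, `twistFactor`, `twistedColdZ` below are VERBATIM copies of idea-10's definitions (`Lines/flux_purity_split.lean` §0, namespace
`FluxPuritySplit`), so that `FluxPuritySplit.twistedColdZ = FluxPurity.twistedColdZ` is `rfl` (crux workfiles are not imported from one
another).  `twistedColdZ_eq_integral_prod`: the time-slicing theorem with the temporal plaquettes of the slab `x₃ = 0` twisted (the tree's
`wilsonFinTorusPartition_eq_integral_prod_finTorusSliceKernel` re-run over `finTorusAction_assemble_twisted`); `twistedColdZ_eq_slicedTwistedZ`: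
for spatially-central `z`, `twistedColdZ ρ β z L (m+2) = slicedTwistedZ ρ β L L L zs (m+2)`; `fluxExitAt_of_coldExitAt`: THE ARROW at plaquette
level, in idea-10's two-sided form `|Z^{(z)} − Z| ≤ 2θ·Z`. -/

section Plaquette

open MeasureTheory Function Filter
open Literature.MathematicalPhysics.QuantumFieldTheory

variable {G : Type} [Group G]

/-- Integer coordinates of a site of `𝕋⁴_{n₀ n₁ n₂ n₃}` (VERBATIM idea-10). -/
def siteCoord {n₀ n₁ n₂ n₃ : ℕ} (x : FinTorusSite n₀ n₁ n₂ n₃) : Fin 4 → ℕ :=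
  ![(x.1 : ℕ), (x.2.1 : ℕ), (x.2.2.1 : ℕ), (x.2.2.2 : ℕ)]

/-- 't Hooft's temporal twist insertion (VERBATIM idea-10): `z μ` on the temporal plaquettes `(μ, 3)` of the stack `x₃ = 0`, `x_μ = 0`. -/
def twistFactor (z : Fin 4 → G) {n₀ n₁ n₂ n₃ : ℕ} (x : FinTorusSite n₀ n₁ n₂ n₃) (μ ν : Fin 4) : G :=
  if ν = 3 ∧ siteCoord x 3 = 0 ∧ siteCoord x μ = 0 then z μ else 1

/-- The slab twist: the slice at time `t` is twisted iff `t = 0`. -/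
def slabTwist {b₁ b₂ b₃ m : ℕ} (zs : Fin 3 → G) (t : Fin m) (a : FinSpatialSite b₁ b₂ b₃ × Fin 3 → G) :
    FinSpatialSite b₁ b₂ b₃ × Fin 3 → G :=
  if (t : ℕ) = 0 then sliceTwist zs a else a

omit [CommGroup Zc] [Fintype Zc] [Group G] in
theorem castSucc_ne_three (j : Fin 3) : (j.castSucc : Fin 4) ≠ 3 := by
  fin_cases j <;> decide

omit [CommGroup Zc] [Fintype Zc] [Group G] in
theorem siteCoord_toSite_three {b₁ b₂ b₃ m : ℕ} (p : FinSpatialSite b₁ b₂ b₃) (t : Fin m) :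
    siteCoord (p.toSite t) 3 = (t : ℕ) := rfl

omit [CommGroup Zc] [Fintype Zc] [Group G] in
theorem siteCoord_toSite_castSucc {b₁ b₂ b₃ m : ℕ} (p : FinSpatialSite b₁ b₂ b₃) (t : Fin m) (i : Fin 3) :
    siteCoord (p.toSite t) i.castSucc = spCoord p i := by
  fin_cases i <;> rfl

omit [CommGroup Zc] [Fintype Zc] in
theorem twistFactor_castSucc_castSucc (z : Fin 4 → G) {n₀ n₁ n₂ n₃ : ℕ} (x : FinTorusSite n₀ n₁ n₂ n₃) (i j : Fin 3) :
    twistFactor z x i.castSucc j.castSucc = 1 := by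
  unfold twistFactor
  rw [if_neg]
  exact fun h => castSucc_ne_three j h.1

omit [CommGroup Zc] [Fintype Zc] in
theorem twistFactor_castSucc_last (z : Fin 4 → G) {b₁ b₂ b₃ m : ℕ} (p : FinSpatialSite b₁ b₂ b₃) (t : Fin m) (i : Fin 3) :
    twistFactor z (p.toSite t) i.castSucc (Fin.last 3) = if (t : ℕ) = 0 ∧ spCoord p i = 0 then z i.castSucc else 1 := by
  unfold twistFactor
  have h3 : (Fin.last 3 : Fin 4) = 3 := rfl
  simp only [h3, true_and, siteCoord_toSite_three, siteCoord_toSite_castSucc]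

/-! Re-proofs of the (private) slicing simp lemmas of `WilsonFinTorusSliceKernel`. -/

omit [CommGroup Zc] [Fintype Zc] [Group G] in
theorem toSite_shift_castSucc' {b₁ b₂ b₃ m : ℕ} (p : FinSpatialSite b₁ b₂ b₃) (t : Fin m) (i : Fin 3) :
    (p.toSite t).shift i.castSucc = (p.shift i).toSite t := by
  fin_cases i <;> rfl

omit [CommGroup Zc] [Fintype Zc] [Group G] in
theorem toSite_shift_last' {b₁ b₂ b₃ m : ℕ} (p : FinSpatialSite b₁ b₂ b₃) (t : Fin m) :
    (p.toSite t).shift (Fin.last 3) = p.toSite (finRotate m t) := rfl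

omit [CommGroup Zc] [Fintype Zc] [Group G] in
theorem finTorusAssemble_toSite_castSucc {b₁ b₂ b₃ m : ℕ}
    (VE : (Fin m → (FinSpatialSite b₁ b₂ b₃ × Fin 3 → G)) × (Fin m → (FinSpatialSite b₁ b₂ b₃ → G)))
    (p : FinSpatialSite b₁ b₂ b₃) (t : Fin m) (i : Fin 3) :
    finTorusAssemble VE (p.toSite t, i.castSucc) = VE.1 t (p, i) := by
  simp only [finTorusAssemble, Fin.lastCases_castSucc]
  rfl

omit [CommGroup Zc] [Fintype Zc] [Group G] in
theorem finTorusAssemble_toSite_last {b₁ b₂ b₃ m : ℕ}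
    (VE : (Fin m → (FinSpatialSite b₁ b₂ b₃ × Fin 3 → G)) × (Fin m → (FinSpatialSite b₁ b₂ b₃ → G)))
    (p : FinSpatialSite b₁ b₂ b₃) (t : Fin m) :
    finTorusAssemble VE (p.toSite t, Fin.last 3) = VE.2 t p := by
  simp only [finTorusAssemble, Fin.lastCases_last]
  rfl

omit [CommGroup Zc] [Fintype Zc] in
theorem finTorusPlaquette_assemble_temporal {b₁ b₂ b₃ m : ℕ}
    (VE : (Fin m → (FinSpatialSite b₁ b₂ b₃ × Fin 3 → G)) × (Fin m → (FinSpatialSite b₁ b₂ b₃ → G)))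
    (p : FinSpatialSite b₁ b₂ b₃) (t : Fin m) (i : Fin 3) :
    finTorusPlaquette (finTorusAssemble VE) (p.toSite t) i.castSucc (Fin.last 3) =
      VE.1 t (p, i) * VE.2 t (p.shift i) * (VE.1 (finRotate m t) (p, i))⁻¹ * (VE.2 t p)⁻¹ := by
  simp only [finTorusPlaquette, toSite_shift_castSucc', toSite_shift_last', finTorusAssemble_toSite_castSucc,
    finTorusAssemble_toSite_last]

omit [CommGroup Zc] [Fintype Zc] in
theorem finTorusPlaquette_assemble_spatial {b₁ b₂ b₃ m : ℕ}
    (VE : (Fin m → (FinSpatialSite b₁ b₂ b₃ × Fin 3 → G)) × (Fin m → (FinSpatialSite b₁ b₂ b₃ → G)))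
    (p : FinSpatialSite b₁ b₂ b₃) (t : Fin m) (i j : Fin 3) :
    finTorusPlaquette (finTorusAssemble VE) (p.toSite t) i.castSucc j.castSucc =
      VE.1 t (p, i) * VE.1 t (p.shift i, j) * (VE.1 t (p.shift j, i))⁻¹ * (VE.1 t (p, j))⁻¹ := by
  simp only [finTorusPlaquette, toSite_shift_castSucc', finTorusAssemble_toSite_castSucc]

variable {N : ℕ} (ρ : G →* Matrix (Fin N) (Fin N) ℂ)

omit [CommGroup Zc] [Fintype Zc] in
/-- **The twisted Wilson action of an assembled configuration splits over the slabs**, the slab `t = 0` carrying the twisted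
slice in the first argument of its temporal energy: `Σ_x Σ_{μ<ν} (N − Re tr ρ(ω_{x,μν} U_{x,μν})) =
Σ_t S_tm(slabTwist zs t (V t), E t, V (t+1)) + Σ_t S_sp(V t)`, `zs i = z i.castSucc`. -/
theorem finTorusAction_assemble_twisted {b₁ b₂ b₃ m : ℕ} (z : Fin 4 → G)
    (VE : (Fin m → (FinSpatialSite b₁ b₂ b₃ × Fin 3 → G)) × (Fin m → (FinSpatialSite b₁ b₂ b₃ → G))) :
    ∑ x : FinTorusSite b₁ b₂ b₃ m, ∑ q : {q : Fin 4 × Fin 4 // q.1 < q.2},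
        ((N : ℝ) - (ρ (twistFactor z x q.1.1 q.1.2 * finTorusPlaquette (finTorusAssemble VE) x q.1.1 q.1.2)).trace.re) =
      (∑ t : Fin m, finTorusTemporalAction ρ (slabTwist (fun i => z i.castSucc) t (VE.1 t)) (VE.2 t)
          (VE.1 (finRotate m t))) +
        ∑ t : Fin m, finTorusSpatialAction ρ (VE.1 t) := by
  rw [← (finTorusSiteSliceEquiv b₁ b₂ b₃ m).symm.sum_comp, Fintype.sum_prod_type, ← Finset.sum_add_distrib]
  refine Finset.sum_congr rfl fun t _ => ?_
  unfold finTorusTemporalAction finTorusSpatialAction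
  rw [← Finset.sum_add_distrib]
  refine Finset.sum_congr rfl fun p _ => ?_
  have e : (finTorusSiteSliceEquiv b₁ b₂ b₃ m).symm (t, p) = p.toSite t := rfl
  rw [e, sum_pairs_eq_sum_castSucc_last_add (g := fun μ ν =>
    (N : ℝ) - (ρ (twistFactor z (p.toSite t) μ ν * finTorusPlaquette (finTorusAssemble VE) (p.toSite t) μ ν)).trace.re)]
  congr 1
  · refine Finset.sum_congr rfl fun i _ => ?_
    rw [finTorusPlaquette_assemble_temporal, twistFactor_castSucc_last]
    unfold slabTwist
    by_cases ht : (t : ℕ) = 0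
    · by_cases hp : spCoord p i = 0
      · simp [ht, hp, sliceTwist, sliceTwistWeight, mul_assoc]
      · simp [ht, hp, sliceTwist, sliceTwistWeight, mul_assoc]
    · simp [ht, mul_assoc]
  · refine Finset.sum_congr rfl fun q _ => ?_
    rw [finTorusPlaquette_assemble_spatial, twistFactor_castSucc_castSucc, one_mul]

omit [CommGroup Zc] [Fintype Zc] in
/-- **The twisted Boltzmann weight factorises over the slabs.** -/
theorem finTorusWeight_assemble_twisted {b₁ b₂ b₃ m : ℕ} (β : ℝ) (z : Fin 4 → G)
    (VE : (Fin m → (FinSpatialSite b₁ b₂ b₃ × Fin 3 → G)) × (Fin m → (FinSpatialSite b₁ b₂ b₃ → G))) :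
    Real.exp (-β * ∑ x : FinTorusSite b₁ b₂ b₃ m, ∑ q : {q : Fin 4 × Fin 4 // q.1 < q.2},
        ((N : ℝ) - (ρ (twistFactor z x q.1.1 q.1.2 * finTorusPlaquette (finTorusAssemble VE) x q.1.1 q.1.2)).trace.re)) =
      (∏ t : Fin m, Real.exp (-(β * finTorusSpatialAction ρ (VE.1 t)))) *
        ∏ t : Fin m, Real.exp (-(β * finTorusTemporalAction ρ (slabTwist (fun i => z i.castSucc) t (VE.1 t)) (VE.2 t)
          (VE.1 (finRotate m t)))) := by
  rw [finTorusAction_assemble_twisted, neg_mul, mul_add, neg_add, Real.exp_add, Finset.mul_sum, Finset.mul_sum,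
    ← Finset.sum_neg_distrib, ← Finset.sum_neg_distrib, Real.exp_sum, Real.exp_sum, mul_comm]

omit [CommGroup Zc] [Fintype Zc] [Group G] in
/-- Symmetrisation of a cyclic chain with bond-dependent weights (tree lemma, `M` now indexed by the bond). -/
theorem prod_exp_mul_prod_eq_prod_symm_perm' {ι Y : Type} [Fintype ι] (σ : Equiv.Perm ι) (mf : Y → ℝ)
    (M : ι → Y → Y → ℝ) (c : ℝ) (V : ι → Y) :
    (∏ t, Real.exp (c * mf (V t))) * ∏ t, M t (V t) (V (σ t)) =
      ∏ t, Real.exp (c / 2 * mf (V t)) * M t (V t) (V (σ t)) * Real.exp (c / 2 * mf (V (σ t))) := by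
  rw [Finset.prod_mul_distrib, Finset.prod_mul_distrib]
  have hshift : ∏ t, Real.exp (c / 2 * mf (V (σ t))) = ∏ t, Real.exp (c / 2 * mf (V t)) :=
    Equiv.prod_comp σ fun t => Real.exp (c / 2 * mf (V t))
  have hsq : (fun t => Real.exp (c * mf (V t))) =
      fun t => Real.exp (c / 2 * mf (V t)) * Real.exp (c / 2 * mf (V t)) := by
    funext t; rw [← Real.exp_add]; ring_nf
  rw [hshift, hsq, Finset.prod_mul_distrib]
  ring

variable [TopologicalSpace G] [IsTopologicalGroup G] [CompactSpace G] [MeasurableSpace G] [BorelSpace G]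

/-- **The temporally twisted Wilson partition function of the cold box `L³ × t`** (VERBATIM idea-10's `twistedColdZ`). -/
def twistedColdZ (β : ℝ) (z : Fin 4 → G) (L t : ℕ) : ℝ :=
  ∫ U, Real.exp (-β * ∑ x : FinTorusSite L L L t, ∑ q : {q : Fin 4 × Fin 4 // q.1 < q.2},
      ((N : ℝ) - (ρ (twistFactor z x q.1.1 q.1.2 * finTorusPlaquette U x q.1.1 q.1.2)).trace.re))
    ∂(Measure.pi fun _ : FinTorusSite L L L t × Fin 4 => haarProbability G)

omit [CommGroup Zc] [Fintype Zc] [CompactSpace G] [MeasurableSpace G] [BorelSpace G] in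
/-- Continuity of the twisted Boltzmann weight in the link configuration. -/
theorem continuous_twistedBoltzmannWeight {b₁ b₂ b₃ m : ℕ} (hρ : Continuous ρ) (β : ℝ) (z : Fin 4 → G) :
    Continuous fun U : FinTorusSite b₁ b₂ b₃ m × Fin 4 → G =>
      Real.exp (-β * ∑ x : FinTorusSite b₁ b₂ b₃ m, ∑ q : {q : Fin 4 × Fin 4 // q.1 < q.2},
        ((N : ℝ) - (ρ (twistFactor z x q.1.1 q.1.2 * finTorusPlaquette U x q.1.1 q.1.2)).trace.re)) := by
  have hU : ∀ l : FinTorusSite b₁ b₂ b₃ m × Fin 4,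
      Continuous fun U : FinTorusSite b₁ b₂ b₃ m × Fin 4 → G => U l := fun l => continuous_apply l
  have hpl : ∀ (x : FinTorusSite b₁ b₂ b₃ m) (μ ν : Fin 4),
      Continuous fun U : FinTorusSite b₁ b₂ b₃ m × Fin 4 → G =>
        twistFactor z x μ ν * finTorusPlaquette U x μ ν := fun x μ ν =>
    continuous_const.mul ((((hU _).mul (hU _)).mul (hU _).inv).mul (hU _).inv)
  have htr : Continuous fun g : G => (ρ g).trace.re := Complex.continuous_re.comp (Continuous.matrix_trace hρ)
  exact Real.continuous_exp.comp (continuous_const.mul (continuous_finsetSum _ fun x _ =>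
    continuous_finsetSum _ fun q _ => continuous_const.sub (htr.comp (hpl x _ _))))

omit [CommGroup Zc] [Fintype Zc] [TopologicalSpace G] [IsTopologicalGroup G] [CompactSpace G] [MeasurableSpace G]
  [BorelSpace G] in
/-- The spatial energy of a slab-twisted slice is that of the slice (spatially central twist). -/
theorem finTorusSpatialAction_slabTwist {b₁ b₂ b₃ m : ℕ} {zs : Fin 3 → G} (hz : ∀ i, zs i ∈ Subgroup.center G)
    (t : Fin m) (a : FinSpatialSite b₁ b₂ b₃ × Fin 3 → G) :
    finTorusSpatialAction ρ (slabTwist zs t a) = finTorusSpatialAction ρ a := by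
  unfold slabTwist
  split
  · exact finTorusSpatialAction_sliceTwist ρ hz a
  · rfl

omit [CommGroup Zc] [Fintype Zc] in
/-- **Twisted time-slicing**: `Z^{(z)}(L³ × m) = ∫ ∏_t K(slabTwist zs t (V t), V (t+1)) dV` — the transfer-matrix form of the twisted
partition function (the bond leaving the slice `t = 0` twisted), for spatially central `z`, `zs i = z i.castSucc`. -/
theorem twistedColdZ_eq_integral_prod [SecondCountableTopology G] (hρ : Continuous ρ) (β : ℝ) (z : Fin 4 → G)
    (hz : ∀ i : Fin 3, z i.castSucc ∈ Subgroup.center G) (L m : ℕ) :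
    twistedColdZ ρ β z L m =
      ∫ V : Fin m → (FinSpatialSite L L L × Fin 3 → G),
        ∏ t, finTorusSliceKernel ρ β (slabTwist (fun i => z i.castSucc) t (V t)) (V (finRotate m t))
        ∂(Measure.pi fun _ => Measure.pi fun _ : FinSpatialSite L L L × Fin 3 => haarProbability G) := by
  have hΦc := continuous_twistedBoltzmannWeight (b₁ := L) (b₂ := L) (b₃ := L) (m := m) ρ hρ β z
  unfold twistedColdZ
  rw [integral_pi_eq_integral_finTorusAssemble (haarProbability G) hΦc.measurable]
  have hint : Integrable (fun VE : (Fin m → (FinSpatialSite L L L × Fin 3 → G)) ×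
      (Fin m → (FinSpatialSite L L L → G)) =>
        Real.exp (-β * ∑ x : FinTorusSite L L L m, ∑ q : {q : Fin 4 × Fin 4 // q.1 < q.2},
          ((N : ℝ) - (ρ (twistFactor z x q.1.1 q.1.2 *
            finTorusPlaquette (finTorusAssemble VE) x q.1.1 q.1.2)).trace.re)))
      ((Measure.pi fun _ : Fin m => Measure.pi fun _ : FinSpatialSite L L L × Fin 3 => haarProbability G).prod
        (Measure.pi fun _ : Fin m => Measure.pi fun _ : FinSpatialSite L L L => haarProbability G)) :=
    (hΦc.comp continuous_finTorusAssemble).integrable_of_hasCompactSupport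
      (IsCompact.of_isClosed_subset isCompact_univ (isClosed_tsupport _) (Set.subset_univ _))
  rw [integral_prod _ hint]
  refine integral_congr_ae (Eventually.of_forall fun V => ?_)
  dsimp only
  simp_rw [finTorusWeight_assemble_twisted ρ β z]
  rw [integral_const_mul]
  have hprod := integral_fintype_prod_eq_prod (𝕜 := ℝ)
    (μ := fun _ : Fin m => Measure.pi fun _ : FinSpatialSite L L L => haarProbability G)
    (fun (t : Fin m) (g : FinSpatialSite L L L → G) =>
      Real.exp (-(β * finTorusTemporalAction ρ (slabTwist (fun i => z i.castSucc) t (V t)) g (V (finRotate m t)))))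
  rw [hprod]
  have hsymm := prod_exp_mul_prod_eq_prod_symm_perm' (finRotate m) (finTorusSpatialAction ρ)
    (fun t a b => ∫ g, Real.exp (-(β * finTorusTemporalAction ρ (slabTwist (fun i => z i.castSucc) t a) g b))
      ∂(Measure.pi fun _ : FinSpatialSite L L L => haarProbability G)) (-β) V
  have e1 : (fun t : Fin m => Real.exp (-(β * finTorusSpatialAction ρ (V t)))) =
      fun t => Real.exp (-β * finTorusSpatialAction ρ (V t)) := by
    funext t; rw [neg_mul]
  rw [e1, hsymm]
  refine Finset.prod_congr rfl fun t _ => ?_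
  unfold finTorusSliceKernel
  rw [finTorusSpatialAction_slabTwist ρ hz]
  congr 1
  · congr 1
    rw [show -β / 2 * finTorusSpatialAction ρ (V t) = -(β * finTorusSpatialAction ρ (V t) / 2) by ring]
  · rw [show -β / 2 * finTorusSpatialAction ρ (V (finRotate m t)) =
      -(β * finTorusSpatialAction ρ (V (finRotate m t)) / 2) by ring]

omit [CommGroup Zc] [Fintype Zc] in
/-- **idea-10's twisted partition function IS the sliced twisted chain** (spatially central `z`; `zs i = z i.castSucc`). -/
theorem twistedColdZ_eq_slicedTwistedZ [SecondCountableTopology G] (hρ : Continuous ρ) (β : ℝ) (z : Fin 4 → G)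
    (hz : ∀ i : Fin 3, z i.castSucc ∈ Subgroup.center G) (L m : ℕ) :
    twistedColdZ ρ β z L (m + 2) = slicedTwistedZ ρ β L L L (fun i => ⟨z i.castSucc, hz i⟩) (m + 2) := by
  simp only [slicedTwistedZ]
  rw [show m + 2 = 1 + m + 1 by ring, twistedColdZ_eq_integral_prod ρ hρ β z hz L (1 + m + 1)]
  refine integral_congr_ae (Eventually.of_forall fun V => ?_)
  dsimp only
  rw [Fin.prod_univ_succ]
  simp only [finRotate_apply, slabTwist, Fin.val_zero, Fin.val_succ, Nat.succ_ne_zero, zero_add, ↓reduceIte]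

/-- **`F_exit(θ)` — idea-10's confined-temporal-twist statement at the EXIT scale** (the `SC` quantifier `∀ ε ∃ L₁ ∀ L ≥ L₁` of
`FluxPuritySplit.ConfinedTemporalTwistSC` replaced by `θ` fixed, `∃ L ≥ 8`; otherwise verbatim: every central temporal twist changes the
partition function of `L³ × t`, `t ∈ {⌊L/4⌋, 2⌊L/4⌋}`, by at most the fraction `θ`). -/
def FluxExitAt (θ : ℝ) : Prop :=
  ∀ (G : Type) [Group G] [TopologicalSpace G] [IsTopologicalGroup G] [CompactSpace G],
    IsCompactSimpleLieGroup G → SimplyConnectedSpace G →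
    letI : MeasurableSpace G := borel G; haveI : BorelSpace G := ⟨rfl⟩;
    ∀ r : LatticeRep G, ∃ β₁ : ℝ, ∀ β : ℝ, β₁ ≤ β → ∃ L : ℕ, 8 ≤ L ∧
      ∀ z : Fin 4 → G, (∀ μ, z μ ∈ Subgroup.center G) → ∀ t : ℕ, (t = L / 4 ∨ t = 2 * (L / 4)) →
        |twistedColdZ r.ρ β z L t - wilsonFinTorusPartition r.ρ β L L L t| ≤
          θ * wilsonFinTorusPartition r.ρ β L L L t

omit [CommGroup Zc] [Fintype Zc] in
/-- **THE ARROW `E(θ) ⇒ F_exit(2θ)` AT PLAQUETTE LEVEL, kernel-checked.**  The bill's seed `ColdExitAt θ` forces, at its own exit scale,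
't Hooft's statement «every electric-flux sector of the cold box is as heavy as the vacuum sector up to `2θ`»:
`|Z^{(z)}(L³×t) − Z(L³×t)| ≤ 2θ·Z(L³×t)`, `t ∈ {⌊L/4⌋, 2⌊L/4⌋}`, every central `z`. -/
theorem fluxExitAt_of_coldExitAt {θ : ℝ} (hE : BasinRung.ColdExitAt θ) : FluxExitAt (2 * θ) := by
  intro G _ _ _ _ hG hsc
  letI : MeasurableSpace G := borel G
  haveI : BorelSpace G := ⟨rfl⟩
  intro r
  haveI : SecondCountableTopology G :=
    (r.continuous.isClosedEmbedding r.injective).isEmbedding.secondCountableTopology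
  obtain ⟨β₁, hβ₁⟩ := hE G hG hsc r
  refine ⟨max β₁ 0, fun β hβ => ?_⟩
  obtain ⟨L, hL, hδ⟩ := hβ₁ β ((le_max_left _ _).trans hβ)
  have hβ0 : 0 ≤ β := (le_max_right _ _).trans hβ
  refine ⟨L, hL, fun z hzc t ht => ?_⟩
  obtain ⟨m, hm⟩ : ∃ m : ℕ, L / 4 = m + 2 := ⟨L / 4 - 2, by omega⟩
  have hδ' : 1 - wilsonFinTorusPartition r.ρ β L L L (2 * (m + 2)) /
      wilsonFinTorusPartition r.ρ β L L L (m + 2) ^ 2 ≤ θ := by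
    have h := hδ
    unfold ColdPurityBridge.coldDefect at h
    rwa [hm] at h
  have hz : ∀ i : Fin 3, z i.castSucc ∈ Subgroup.center G := fun i => hzc _
  have key := slicedTwist_cost_le_of_purity r.continuous r.mem_unitary hβ0 L L L m hδ' (fun i => ⟨z i.castSucc, hz i⟩)
  -- the generic step: `Z^{tw} ≤ Z`, `1 − Z^{tw}/Z ≤ 2θ`, `Z > 0` ⇒ `|Z^{tw} − Z| ≤ 2θ Z`
  have step : ∀ n : ℕ, 1 - slicedTwistedZ r.ρ β L L L (fun i => ⟨z i.castSucc, hz i⟩) (n + 2) /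
        wilsonFinTorusPartition r.ρ β L L L (n + 2) ≤ 2 * θ →
      |twistedColdZ r.ρ β z L (n + 2) - wilsonFinTorusPartition r.ρ β L L L (n + 2)| ≤
        2 * θ * wilsonFinTorusPartition r.ρ β L L L (n + 2) := by
    intro n hlow
    have hW : 0 < wilsonFinTorusPartition r.ρ β L L L (n + 2) := wilsonFinTorusPartition_pos r.continuous β L L L _
    rw [twistedColdZ_eq_slicedTwistedZ r.ρ r.continuous β z hz L n]
    have hup := key.2.1 n
    rw [abs_sub_comm, abs_of_nonneg (sub_nonneg.2 hup)]
    rw [one_sub_div hW.ne', div_le_iff₀ hW] at hlow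
    exact hlow
  rcases ht with rfl | rfl
  · rw [hm]
    exact step m key.2.2.1
  · rw [hm, show 2 * (m + 2) = 2 * m + 2 + 2 by ring]
    refine step (2 * m + 2) ?_
    rw [show 2 * m + 2 + 2 = 2 * (m + 2) by ring]
    exact key.2.2.2

end Plaquette

end Summit.QuantumFields.YangMills.Cruxes.IR.FluxPurity
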